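import Literature.Topology.FourManifolds.BandSumArcMatching
import Literature.Topology.FourManifolds.LiftedArcFamily
import HarnessLib

/-!
# Band sums with the same regular band: the family of knots moving one arc window

Fact seat `provefact-Literature.Topology.FourManifolds.BandData.exists_ambientIsotopy_of_band_eq_of_isRegular`
(`BandSumIsotopyRegular.lean`). For band-sum data `b`, `b'` with the same regular band (thickened,
`T`), disjoint summands, lifts `φ`, `φ'` of the two closed lower arcs and a window matching `σ`
(`BandSumArcMatching.lean`, packaged with its hypotheses as `BandData.WindowMatching`), this file
defines the **family of piece functions** `BandData.WindowMatching.fam κ c u : ℝ → ℝ⁴` which moves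
the lower arc of `K` onto the lower arc of `K'` over the window `[φ 0, φ 1]` through *embedded space
arcs* in the thickened band — in the slab coordinates (planar `x ∈ ℝ²`, height `z`) of the
thickening it is the lifted two-arc family of `LiftedArcFamily.lean`,

  `X_u (t) = (1 - u) x (t) + u x' (σ t)`, `Z_u (t) = (1 - u) z (t) + u z' (σ t) + c u (1 - u) ζ (t) e`,

(`x, z` the planar/height tracks of `K`, `x', z'` those of `K' ∘ σ`, `u` clamped into `[0, 1]`),
and proves the properties consumed by the assembly (`Knot.IsModification`,
`KnotFamilyAmbientIsotopy.lean`): off the open window and at `u = 0` it is the curve of `K`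
(`fam_eq_curve_of_not_mem`, `fam_zero`), at `u = 1` it is the curve of `K' ∘ σ` (`fam_one`), it is
jointly `C^∞` over the strip (`contDiffAt_fam`), and on the window it is the thickening of the
lifted two-arc family (`fam_eq_of_mem`), whose planar part stays in the closed lower half of the
collar square (`planarFam_mem`).

Everything here is proved; no named facts are introduced.

## References

* R. E. Gompf, A. I. Stipsicz, *4-Manifolds and Kirby Calculus* (1999), §5.1 (band sums along a
  given band). [GompfStipsicz1999]
* M. W. Hirsch, *Differential Topology* (1976), Ch. 8 §1, Thm. 1.3. [HirschDT1976]

## Design notes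

* The family parameter is clamped inside `fam` (by `Real.smoothTransition`) so that the planar
  convex combination never leaves the closed collar square, over which the inverse
  parametrisation `paramInv` of the thickening is smooth.
* `WindowMatching` bundles the standing hypotheses (`b.δ < δ₁`, disjoint summands, same band and
  collar, the two lifts) with the matching `σ`, so that the lemmas take `W` only.
* Local notation `𝔼 n`, `𝕊 n` follows the directory pattern. Nothing here uses `sorry`.
-/

open scoped Manifold ContDiff Topology Real
open Function Set Metric Filter

noncomputable section

namespace Literature.Topology.FourManifolds

/-- Local notation: `𝔼 n` is the model Euclidean space `EuclideanSpace ℝ (Fin n)`. -/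
local notation "𝔼 " n:arg => EuclideanSpace ℝ (Fin n)

/-- Local notation: `𝕊 n` is the unit sphere in `EuclideanSpace ℝ (Fin (n + 1))`. -/
local notation "𝕊 " n:arg => (Metric.sphere (0 : EuclideanSpace ℝ (Fin (n + 1))) 1)

attribute [local instance] fact_finrank_euclideanSpace_four

/-! ## The thickening as a smooth injective map `ℝ² × ℝ¹ → ℝ⁴`; tracks of knots -/

namespace PatchThickening

variable {β : 𝔼 2 → 𝕊 3} {δ₀ δ₁ : ℝ} (T : PatchThickening β δ₀ δ₁)

/-- The thickening read in `ℝ⁴` on slab coordinates: `(y, z) ↦ emb (y, z) ∈ 𝕊³ ⊆ ℝ⁴`. [folklore] -/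
def slabMap (q : (𝔼 2) × 𝔼 1) : 𝔼 4 := ((T.emb (slabEquiv.symm q) : 𝕊 3) : 𝔼 4)

/-- Unfolding of `slabMap`. [folklore] -/
theorem slabMap_apply (y : 𝔼 2) (z : 𝔼 1) :
    T.slabMap (y, z) = ((T.emb (slabEquiv.symm (y, z)) : 𝕊 3) : 𝔼 4) := rfl

/-- The thickening read in `ℝ⁴` is smooth on `ℝ³`. [folklore] -/
theorem contDiff_coe_emb : ContDiff ℝ ∞ fun w : 𝔼 3 ↦ ((T.emb w : 𝕊 3) : 𝔼 4) :=
  contMDiff_iff_contDiff.1 (contMDiff_coe_sphere.comp T.isSmoothEmbedding.contMDiff)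

/-- `slabMap` is smooth. [folklore] -/
theorem contDiff_slabMap : ContDiff ℝ ∞ T.slabMap :=
  T.contDiff_coe_emb.comp slabEquiv.symm.contDiff

/-- `slabMap` is injective. [folklore] -/
theorem injective_slabMap : Injective T.slabMap := fun _ _ h ↦
  slabEquiv.symm.injective (T.injective_emb (Subtype.ext h))

/-- `slabMap` takes values on the unit sphere. [folklore] -/
theorem norm_slabMap (q : (𝔼 2) × 𝔼 1) : ‖T.slabMap q‖ = 1 := by
  rw [slabMap, norm_eq_of_mem_sphere]

/-- `paramInv` is injective on the image of `param`. [folklore] -/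
theorem injOn_paramInv : InjOn T.paramInv (range T.param) := fun x hx x' hx' h ↦ by
  rw [← T.param_paramInv hx, ← T.param_paramInv hx', h]

/-- `paramInv` is smooth at points of the (open) image of `param`. [folklore] -/
theorem contDiffAt_paramInv {x : 𝔼 2} (hx : x ∈ range T.param) : ContDiffAt ℝ ∞ T.paramInv x :=
  T.contDiffOn_paramInv.contDiffAt (T.isOpen_range_param.mem_nhds hx)

/-- A point of the image of the thickening, read in `ℝ⁴`, is `slabMap` of its coordinates.
[folklore] -/
theorem slabMap_coords {c : 𝕊 3} (hc : c ∈ range T.emb) :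
    T.slabMap (T.paramInv (T.planar c), T.height c) = (c : 𝔼 4) := by
  rw [slabMap_apply, T.emb_paramInv_planar hc]

/-- The **planar track** of a knot in the thickening: `t ↦ planar (L (circlePt t))`. [folklore] -/
abbrev ptrack (L : Knot) (t : ℝ) : 𝔼 2 := T.planar (L (circlePt t))

/-- The **height track** of a knot in the thickening: `t ↦ height (L (circlePt t))`. [folklore] -/
abbrev htrack (L : Knot) (t : ℝ) : 𝔼 1 := T.height (L (circlePt t))

/-- Unfolding of `ptrack`. [folklore] -/
theorem ptrack_apply (L : Knot) (t : ℝ) : T.ptrack L t = T.planar (L (circlePt t)) := rfl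

/-- Unfolding of `htrack`. [folklore] -/
theorem htrack_apply (L : Knot) (t : ℝ) : T.htrack L t = T.height (L (circlePt t)) := rfl

end PatchThickening

/-! ## Auxiliary one-variable profiles -/

/-- The height profile of the window of `φ` with margin `κ`: zero on
`(-∞, φ 0 + κ/2] ∪ [φ 1 - κ/2, ∞)`, the signed distance from the midpoint on `[φ 0 + κ, φ 1 - κ]`
(`liftBump`). [folklore] -/
def windowBump (φ : ℝ → ℝ) (κ : ℝ) : ℝ → ℝ := liftBump (φ 0) (φ 1) (κ / 2) κ

/-- The unit height vector of `ℝ¹`. [folklore] -/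
def hUnit : 𝔼 1 := EuclideanSpace.single (0 : Fin 1) (1 : ℝ)

/-- The clamp of the family parameter into `[0, 1]`. [folklore] -/
def clamp01 (u : ℝ) : ℝ := Real.smoothTransition u

/-- The clamp takes values in `[0, 1]`. [folklore] -/
theorem clamp01_mem (u : ℝ) : clamp01 u ∈ Icc (0 : ℝ) 1 :=
  ⟨Real.smoothTransition.nonneg u, Real.smoothTransition.le_one u⟩

/-- The clamp at `0`. [folklore] -/
@[simp] theorem clamp01_zero : clamp01 0 = 0 := Real.smoothTransition.zero

/-- The clamp at `1`. [folklore] -/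
@[simp] theorem clamp01_one : clamp01 1 = 1 := Real.smoothTransition.one

/-- The clamp is smooth. [folklore] -/
theorem contDiff_clamp01 : ContDiff ℝ ∞ clamp01 := Real.smoothTransition.contDiff

/-- The unit height vector is nonzero. [folklore] -/
theorem hUnit_ne_zero : hUnit ≠ 0 := by
  intro h
  have := congrArg (fun v : 𝔼 1 ↦ v 0) h
  simp [hUnit] at this

/-- The unit height vector has norm one. [folklore] -/
theorem norm_hUnit : ‖hUnit‖ = 1 := by simp [hUnit]

/-- The height profile is smooth. [folklore] -/
theorem contDiff_windowBump (φ : ℝ → ℝ) (κ : ℝ) : ContDiff ℝ ∞ (windowBump φ κ) := contDiff_liftBump _ _ _ _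

/-- Off the open window the height profile vanishes. [folklore] -/
theorem windowBump_eq_zero {φ : ℝ → ℝ} {κ t : ℝ} (hκ : 0 < κ) (hnot : t ∉ Ioo (φ 0) (φ 1)) :
    windowBump φ κ t = 0 := by
  rw [mem_Ioo, not_and_or, not_lt, not_lt] at hnot
  have hκ' : κ / 2 < κ := by linarith
  rcases hnot with h | h
  · exact liftBump_eq_zero_of_le hκ' (by linarith)
  · exact liftBump_eq_zero_of_ge hκ' (by linarith)

/-! ## Convexity of the collar regions -/

/-- The closed collar square is convex. [folklore] -/
theorem convex_closedSquare (δ : ℝ) : Convex ℝ (closedSquare δ) := by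
  have : closedSquare δ = ⋂ i : Fin 2, (fun x : 𝔼 2 ↦ x i) ⁻¹' Icc (-δ) (1 + δ) := by
    ext x; simp [closedSquare]
  rw [this]
  exact convex_iInter fun i ↦ (convex_Icc _ _).linear_preimage (EuclideanSpace.proj i).toLinearMap

/-- The open lower half `{x ∈ squareNhd δ | x₁ < 1/2}` is convex. [folklore] -/
theorem convex_squareNhd_inter_lt (δ : ℝ) :
    Convex ℝ {x : 𝔼 2 | x ∈ squareNhd δ ∧ x 1 < 2⁻¹} := by
  have : {x : 𝔼 2 | x ∈ squareNhd δ ∧ x 1 < 2⁻¹} =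
      (⋂ i : Fin 2, (fun x : 𝔼 2 ↦ x i) ⁻¹' Ioo (-δ) (1 + δ)) ∩ (fun x : 𝔼 2 ↦ x 1) ⁻¹' Iio 2⁻¹ := by
    ext x
    simp only [mem_setOf_eq, mem_squareNhd_iff, mem_inter_iff, mem_iInter, mem_preimage, mem_Iio]
  rw [this]
  exact (convex_iInter fun i ↦ (convex_Ioo _ _).linear_preimage (EuclideanSpace.proj i).toLinearMap).inter
    ((convex_Iio _).linear_preimage (EuclideanSpace.proj (1 : Fin 2)).toLinearMap)

namespace BandData

variable {K₁ K₂ K K' : Knot} {avoid avoid' : Set (𝕊 3)} {b : BandData K₁ K₂ K avoid}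
  {b' : BandData K₁ K₂ K' avoid'} {δ₀ δ₁ : ℝ} {T : PatchThickening b.band δ₀ δ₁} {φ φ' : ℝ → ℝ}

variable (b b' T φ φ') in
/-- **A window matching** of the lower arcs of `b`, `b'` over the window of the lift `φ`: the
standing hypotheses (thickening over a wider collar, disjoint summands, same band and collar, the
two lifts) together with the data produced by `exists_windowMatching` — the margin `η` of the strip
`(φ 0 - η, φ 1 + η)` and the re-parametrisation `σ` — and their properties. [folklore] -/
structure WindowMatching where
  /-- The thickening covers the closed collar. -/
  δ_lt : b.δ < δ₁
  /-- The summands are disjoint. -/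
  disjoint : Disjoint (range K₁) (range K₂)
  /-- Same band. -/
  band_eq : b'.band = b.band
  /-- Same collar width. -/
  δ_eq : b'.δ = b.δ
  /-- `φ` lifts the closed lower arc of `b`. -/
  lift : b.IsLowerLift φ
  /-- `φ'` lifts the closed lower arc of `b'`. -/
  lift' : b'.IsLowerLift φ'
  /-- The margin of the strip around the window. -/
  η : ℝ
  /-- The re-parametrisation of the window of `K'` over the window of `K`. -/
  σ : ℝ → ℝ
  /-- The margin is positive. -/
  η_pos : 0 < η
  /-- `σ` is smooth with positive derivative on the strip. -/
  smooth : ∀ t ∈ Ioo (φ 0 - η) (φ 1 + η), ContDiffAt ℝ ∞ σ t ∧ 0 < deriv σ t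
  /-- `σ` is strictly increasing on the strip. -/
  strictMonoOn : StrictMonoOn σ (Ioo (φ 0 - η) (φ 1 + η))
  /-- `σ` maps the start of the window to the start of the window. -/
  σ_zero : σ (φ 0) = φ' 0
  /-- `σ` maps the end of the window to the end of the window. -/
  σ_one : σ (φ 1) = φ' 1
  /-- `σ` maps the window into the window. -/
  mapsTo : MapsTo σ (Icc (φ 0) (φ 1)) (Icc (φ' 0) (φ' 1))
  /-- `σ` maps the window onto the window. -/
  surjOn : SurjOn σ (Icc (φ 0) (φ 1)) (Icc (φ' 0) (φ' 1))
  /-- Both tracks lie in the image of the thickening over the strip. -/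
  track_mem : ∀ t ∈ Ioo (φ 0 - η) (φ 1 + η), K (circlePt t) ∈ range T.emb ∧ K' (circlePt (σ t)) ∈ range T.emb
  /-- Near the ends of the window the planar `x₁`-coordinates agree. -/
  planar_one_eq : ∀ t ∈ Ioo (φ 0 - η) (φ 0 + η) ∪ Ioo (φ 1 - η) (φ 1 + η),
    T.planar (K' (circlePt (σ t))) 1 = T.planar (K (circlePt t)) 1
  /-- Off the open window the two points coincide. -/
  apply_eq_of_not_mem : ∀ t ∈ Ioo (φ 0 - η) (φ 1 + η), t ∉ Ioo (φ 0) (φ 1) → K' (circlePt (σ t)) = K (circlePt t)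

variable (b b' T) in
/-- Window matchings exist (for data with the same band and collar, thickened over a wider collar,
with disjoint summands). [folklore] -/
theorem nonempty_windowMatching (hδ₁ : b.δ < δ₁) (hdisj : Disjoint (range K₁) (range K₂))
    (hband : b'.band = b.band) (hδ : b'.δ = b.δ) (hφ : b.IsLowerLift φ) (hφ' : b'.IsLowerLift φ') :
    Nonempty (WindowMatching b b' T φ φ') := by
  obtain ⟨η, hη, σ, h1, h2, h3, h4, h5, h6, h7, h8, h9⟩ :=
    b.exists_windowMatching b' T hδ₁ hdisj hband hδ hφ hφ'
  exact ⟨⟨hδ₁, hdisj, hband, hδ, hφ, hφ', η, σ, hη, h1, h2, h3, h4, h5, h6, h7, h8, h9⟩⟩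

namespace WindowMatching

variable (W : WindowMatching b b' T φ φ')
include W

/-! ## The tracks and the family -/

/-- The planar track of `K' ∘ σ`. [folklore] -/
def x' (t : ℝ) : 𝔼 2 := T.ptrack K' (W.σ t)

/-- The height track of `K' ∘ σ`. [folklore] -/
def z' (t : ℝ) : 𝔼 1 := T.htrack K' (W.σ t)

/-- The planar part of the family: `X_u = (1 - u) x + u x'` (parameter clamped). [folklore] -/
def planarFam (u t : ℝ) : 𝔼 2 := famX (T.ptrack K) W.x' (clamp01 u) t

/-- The height part of the family: `(1 - u) z + u z' + c u (1 - u) ζ e` (parameter clamped).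
[folklore] -/
def heightFam (κ c : ℝ) (u t : ℝ) : 𝔼 1 :=
  (1 - clamp01 u) • T.htrack K t + clamp01 u • W.z' t + famZ (windowBump φ κ) c hUnit (clamp01 u) t

/-- **The family of piece functions** moving the lower arc of `K` onto that of `K'` over the window,
read in `ℝ⁴`: `slabMap (paramInv X_u, Z_u)`. [folklore] -/
def fam (κ c : ℝ) (u t : ℝ) : 𝔼 4 := T.slabMap (T.paramInv (W.planarFam u t), W.heightFam κ c u t)

/-! ### Elementary identities -/

/-- Off the open window the two planar tracks agree (on the strip). [folklore] -/
theorem x'_eq {t : ℝ} (ht : t ∈ Ioo (φ 0 - W.η) (φ 1 + W.η)) (hnot : t ∉ Ioo (φ 0) (φ 1)) :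
    W.x' t = T.ptrack K t := by
  rw [x', PatchThickening.ptrack_apply, PatchThickening.ptrack_apply, W.apply_eq_of_not_mem t ht hnot]

/-- Off the open window the two height tracks agree (on the strip). [folklore] -/
theorem z'_eq {t : ℝ} (ht : t ∈ Ioo (φ 0 - W.η) (φ 1 + W.η)) (hnot : t ∉ Ioo (φ 0) (φ 1)) :
    W.z' t = T.htrack K t := by
  rw [z', PatchThickening.htrack_apply, PatchThickening.htrack_apply, W.apply_eq_of_not_mem t ht hnot]

/-- **Off the open window the family is the curve of `K`** (on the strip, at every time).
[folklore] -/
theorem fam_eq_curve_of_not_mem {κ : ℝ} (hκ : 0 < κ) (c u : ℝ) {t : ℝ} (ht : t ∈ Ioo (φ 0 - W.η) (φ 1 + W.η))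
    (hnot : t ∉ Ioo (φ 0) (φ 1)) : W.fam κ c u t = Knot.curve K t := by
  have hX : W.planarFam u t = T.ptrack K t := by rw [planarFam, famX_eq_of_eq (W.x'_eq ht hnot)]
  have hZ : W.heightFam κ c u t = T.htrack K t := by
    rw [heightFam, W.z'_eq ht hnot, famZ_eq_zero_of_eq_zero (windowBump_eq_zero hκ hnot), add_zero,
      ← add_smul]
    ring_nf; exact one_smul _ _
  rw [fam, hX, hZ, PatchThickening.ptrack_apply, PatchThickening.htrack_apply,
    T.slabMap_coords (W.track_mem t ht).1, Knot.curve_apply]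

/-- **At time `0` the family is the curve of `K`** (on the strip). [folklore] -/
theorem fam_zero (κ c : ℝ) {t : ℝ} (ht : t ∈ Ioo (φ 0 - W.η) (φ 1 + W.η)) : W.fam κ c 0 t = Knot.curve K t := by
  have hX : W.planarFam 0 t = T.ptrack K t := by rw [planarFam, clamp01_zero, famX_zero]
  have hZ : W.heightFam κ c 0 t = T.htrack K t := by simp [heightFam]
  rw [fam, hX, hZ, PatchThickening.ptrack_apply, PatchThickening.htrack_apply,
    T.slabMap_coords (W.track_mem t ht).1, Knot.curve_apply]

/-- **At time `1` the family is the curve of `K' ∘ σ`** (on the strip). [folklore] -/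
theorem fam_one (κ c : ℝ) {t : ℝ} (ht : t ∈ Ioo (φ 0 - W.η) (φ 1 + W.η)) :
    W.fam κ c 1 t = Knot.curve K' (W.σ t) := by
  have hX : W.planarFam 1 t = W.x' t := by rw [planarFam, clamp01_one, famX_one]
  have hZ : W.heightFam κ c 1 t = W.z' t := by simp [heightFam]
  rw [fam, hX, hZ, x', z', PatchThickening.ptrack_apply, PatchThickening.htrack_apply,
    T.slabMap_coords (W.track_mem t ht).2, Knot.curve_apply]

/-- The family takes values on the unit sphere. [folklore] -/
theorem norm_fam (κ c u t : ℝ) : ‖W.fam κ c u t‖ = 1 := T.norm_slabMap _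

/-! ### Smoothness over the strip -/

/-- The planar track of `K` is smooth on the strip. [folklore] -/
theorem contDiffAt_x {t : ℝ} (ht : t ∈ Ioo (φ 0 - W.η) (φ 1 + W.η)) : ContDiffAt ℝ ∞ (T.ptrack K) t :=
  T.contDiffAt_planar_track K (W.track_mem t ht).1

/-- The height track of `K` is smooth on the strip. [folklore] -/
theorem contDiffAt_z {t : ℝ} (ht : t ∈ Ioo (φ 0 - W.η) (φ 1 + W.η)) : ContDiffAt ℝ ∞ (T.htrack K) t :=
  T.contDiffAt_height_track K (W.track_mem t ht).1

/-- The planar track of `K' ∘ σ` is smooth on the strip. [folklore] -/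
theorem contDiffAt_x' {t : ℝ} (ht : t ∈ Ioo (φ 0 - W.η) (φ 1 + W.η)) : ContDiffAt ℝ ∞ W.x' t :=
  (T.contDiffAt_planar_track K' (W.track_mem t ht).2).comp t (W.smooth t ht).1

/-- The height track of `K' ∘ σ` is smooth on the strip. [folklore] -/
theorem contDiffAt_z' {t : ℝ} (ht : t ∈ Ioo (φ 0 - W.η) (φ 1 + W.η)) : ContDiffAt ℝ ∞ W.z' t :=
  (T.contDiffAt_height_track K' (W.track_mem t ht).2).comp t (W.smooth t ht).1

/-- The planar part of the family is jointly smooth over the strip. [folklore] -/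
theorem contDiffAt_planarFam {p : ℝ × ℝ} (hp : p.2 ∈ Ioo (φ 0 - W.η) (φ 1 + W.η)) :
    ContDiffAt ℝ ∞ (uncurry W.planarFam) p := by
  have hx : ContDiffAt ℝ ∞ (fun q : ℝ × ℝ ↦ T.ptrack K q.2) p := (W.contDiffAt_x hp).comp p contDiffAt_snd
  have hx' : ContDiffAt ℝ ∞ (fun q : ℝ × ℝ ↦ W.x' q.2) p := (W.contDiffAt_x' hp).comp p contDiffAt_snd
  have hυ : ContDiffAt ℝ ∞ (fun q : ℝ × ℝ ↦ clamp01 q.1) p := contDiff_clamp01.contDiffAt.comp p contDiffAt_fst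
  have : uncurry W.planarFam = fun q : ℝ × ℝ ↦ (1 - clamp01 q.1) • T.ptrack K q.2 + clamp01 q.1 • W.x' q.2 := by
    funext q; rfl
  rw [this]
  exact ((contDiffAt_const.sub hυ).smul hx).add (hυ.smul hx')

/-- The height part of the family is jointly smooth over the strip. [folklore] -/
theorem contDiffAt_heightFam (κ c : ℝ) {p : ℝ × ℝ} (hp : p.2 ∈ Ioo (φ 0 - W.η) (φ 1 + W.η)) :
    ContDiffAt ℝ ∞ (uncurry (W.heightFam κ c)) p := by
  have hz : ContDiffAt ℝ ∞ (fun q : ℝ × ℝ ↦ T.htrack K q.2) p := (W.contDiffAt_z hp).comp p contDiffAt_snd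
  have hz' : ContDiffAt ℝ ∞ (fun q : ℝ × ℝ ↦ W.z' q.2) p := (W.contDiffAt_z' hp).comp p contDiffAt_snd
  have hυ : ContDiffAt ℝ ∞ (fun q : ℝ × ℝ ↦ clamp01 q.1) p := contDiff_clamp01.contDiffAt.comp p contDiffAt_fst
  have hζ : ContDiffAt ℝ ∞ (fun q : ℝ × ℝ ↦ windowBump φ κ q.2) p :=
    (contDiff_windowBump φ κ).contDiffAt.comp p contDiffAt_snd
  have : uncurry (W.heightFam κ c) = fun q : ℝ × ℝ ↦ (1 - clamp01 q.1) • T.htrack K q.2 + clamp01 q.1 • W.z' q.2 +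
      (c * (clamp01 q.1 * (1 - clamp01 q.1)) * windowBump φ κ q.2) • hUnit := by
    funext q; rfl
  rw [this]
  exact (((contDiffAt_const.sub hυ).smul hz).add (hυ.smul hz')).add
    (((contDiffAt_const.mul (hυ.mul (contDiffAt_const.sub hυ))).mul hζ).smul contDiffAt_const)

/-- The planar part lies on the segment between the two tracks. [folklore] -/
theorem planarFam_mem_segment (u t : ℝ) : W.planarFam u t ∈ segment ℝ (T.ptrack K t) (W.x' t) :=
  famX_mem_segment (clamp01_mem u) t

/-! ### The tracks on the window -/

/-- On the window the planar track of `K` is on the planar lower arc: in the closed collar square,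
with `x₁ < 1/2`, and the height vanishes. [folklore] -/
theorem x_mem {t : ℝ} (ht : t ∈ Icc (φ 0) (φ 1)) :
    T.ptrack K t ∈ closedSquare b.δ ∧ T.ptrack K t 1 < 2⁻¹ ∧ T.htrack K t = 0 := by
  obtain ⟨s, hs, -, -, -, hpl, hh, hsq⟩ := W.lift.track_of_mem T W.δ_lt ht
  refine ⟨by rw [PatchThickening.ptrack_apply, hpl]; exact hsq, ?_, hh⟩
  exact W.lift.planar_apply_one_lt T W.δ_lt ht

/-- On the open window the planar track of `K` is in the open lower half. [folklore] -/
theorem x_mem_of_mem_Ioo {t : ℝ} (ht : t ∈ Ioo (φ 0) (φ 1)) : T.ptrack K t ∈ squareNhd b.δ ∧ T.ptrack K t 1 < 2⁻¹ :=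
  W.lift.planar_mem_of_mem_Ioo T W.δ_lt ht

/-- `σ` maps the open window into the open window. [folklore] -/
theorem σ_mem_Ioo {t : ℝ} (ht : t ∈ Ioo (φ 0) (φ 1)) : W.σ t ∈ Ioo (φ' 0) (φ' 1) := by
  rw [← W.σ_zero, ← W.σ_one]
  have hη := W.η_pos
  have h01 := W.lift.zero_lt_one
  exact ⟨W.strictMonoOn ⟨by linarith, by linarith⟩ ⟨by linarith [ht.1], by linarith [ht.2]⟩ ht.1,
    W.strictMonoOn ⟨by linarith [ht.1], by linarith [ht.2]⟩ ⟨by linarith, by linarith⟩ ht.2⟩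

/-- On the window the planar track of `K' ∘ σ` is on the planar lower arc of `b'`: in the closed
collar square, with `x₁ < 1/2`, and the height vanishes. [folklore] -/
theorem x'_mem {t : ℝ} (ht : t ∈ Icc (φ 0) (φ 1)) : W.x' t ∈ closedSquare b.δ ∧ W.x' t 1 < 2⁻¹ ∧ W.z' t = 0 := by
  obtain ⟨T', -, -, -, hT'p, hT'h⟩ := PatchThickening.exists_cast W.band_eq T
  have hδ₁' : b'.δ < δ₁ := W.δ_eq ▸ W.δ_lt
  have hσt : W.σ t ∈ Icc (φ' 0) (φ' 1) := W.mapsTo ht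
  obtain ⟨s, hs, -, -, -, hpl, hh, hsq⟩ := W.lift'.track_of_mem T' hδ₁' hσt
  refine ⟨?_, ?_, ?_⟩
  · rw [x', PatchThickening.ptrack_apply, ← hT'p, hpl, ← W.δ_eq]; exact hsq
  · have := W.lift'.planar_apply_one_lt T' hδ₁' hσt
    rwa [hT'p] at this
  · rw [z', PatchThickening.htrack_apply, ← hT'h]; exact hh

/-- On the open window the planar track of `K' ∘ σ` is in the open lower half. [folklore] -/
theorem x'_mem_of_mem_Ioo {t : ℝ} (ht : t ∈ Ioo (φ 0) (φ 1)) : W.x' t ∈ squareNhd b.δ ∧ W.x' t 1 < 2⁻¹ := by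
  obtain ⟨T', -, -, -, hT'p, -⟩ := PatchThickening.exists_cast W.band_eq T
  have hδ₁' : b'.δ < δ₁ := W.δ_eq ▸ W.δ_lt
  have := W.lift'.planar_mem_of_mem_Ioo T' hδ₁' (W.σ_mem_Ioo ht)
  rw [hT'p, W.δ_eq] at this
  exact this

/-- On the window the planar part of the family lies in the closed collar square and in
`{x₁ < 1/2}`. [folklore] -/
theorem planarFam_mem (u : ℝ) {t : ℝ} (ht : t ∈ Icc (φ 0) (φ 1)) :
    W.planarFam u t ∈ closedSquare b.δ ∧ W.planarFam u t 1 < 2⁻¹ := by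
  obtain ⟨hx, hx1, -⟩ := W.x_mem ht
  obtain ⟨hx', hx1', -⟩ := W.x'_mem ht
  refine ⟨(convex_closedSquare b.δ).segment_subset hx hx' (W.planarFam_mem_segment u t), ?_⟩
  rw [planarFam, famX_apply]
  have hu := clamp01_mem u
  nlinarith [mul_le_mul_of_nonneg_left hx1.le (sub_nonneg.2 hu.2), mul_le_mul_of_nonneg_left hx1'.le hu.1,
    hu.1, hu.2]

/-- On the open window the planar part of the family lies in the open lower half. [folklore] -/
theorem planarFam_mem_of_mem_Ioo (u : ℝ) {t : ℝ} (ht : t ∈ Ioo (φ 0) (φ 1)) :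
    W.planarFam u t ∈ squareNhd b.δ ∧ W.planarFam u t 1 < 2⁻¹ := by
  have h := (convex_squareNhd_inter_lt b.δ).segment_subset (W.x_mem_of_mem_Ioo ht) (W.x'_mem_of_mem_Ioo ht)
    (W.planarFam_mem_segment u t)
  exact h

/-- Over the strip the planar part of the family lies in the image of the parametrisation.
[folklore] -/
theorem planarFam_mem_range_param (u : ℝ) {t : ℝ} (ht : t ∈ Ioo (φ 0 - W.η) (φ 1 + W.η)) :
    W.planarFam u t ∈ range T.param := by
  by_cases hin : t ∈ Ioo (φ 0) (φ 1)
  · exact b.closedSquare_subset_range_param T W.δ_lt (W.planarFam_mem u (Ioo_subset_Icc_self hin)).1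
  · rw [planarFam, famX_eq_of_eq (W.x'_eq ht hin)]; exact T.planar_mem_range_param _

/-- **The family is jointly smooth over the strip.** [folklore] -/
theorem contDiffAt_fam (κ c : ℝ) {p : ℝ × ℝ} (hp : p.2 ∈ Ioo (φ 0 - W.η) (φ 1 + W.η)) :
    ContDiffAt ℝ ∞ (uncurry (W.fam κ c)) p := by
  have h1 : ContDiffAt ℝ ∞ (fun q : ℝ × ℝ ↦ T.paramInv (W.planarFam q.1 q.2)) p :=
    (T.contDiffAt_paramInv (W.planarFam_mem_range_param p.1 hp)).comp p (W.contDiffAt_planarFam hp)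
  have h2 := W.contDiffAt_heightFam κ c hp
  exact T.contDiff_slabMap.contDiffAt.comp p (h1.prodMk h2)

/-- **On the window the family is the thickening of the lifted two-arc family**:
`fam u t = slabMap (paramInv X_u (t), Z_u (t))` with `(X, Z) = liftFam x x' ζ c e` at the clamped
parameter. [folklore] -/
theorem fam_eq_of_mem (κ c u : ℝ) {t : ℝ} (ht : t ∈ Icc (φ 0) (φ 1)) :
    W.fam κ c u t = T.slabMap (T.paramInv (liftFam (T.ptrack K) W.x' (windowBump φ κ) c hUnit (clamp01 u) t).1,
      (liftFam (T.ptrack K) W.x' (windowBump φ κ) c hUnit (clamp01 u) t).2) := by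
  have hz : T.htrack K t = 0 := (W.x_mem ht).2.2
  have hz' : W.z' t = 0 := (W.x'_mem ht).2.2
  rw [fam, heightFam, hz, hz', smul_zero, smul_zero, zero_add, zero_add]
  rfl

/-! ### Values of the tracks at the ends of the window -/

/-- The planar track of `K` at the start of the window is the corner `A = (0, -δ)`. [folklore] -/
theorem x_zero : T.ptrack K (φ 0) = pt2 0 (-b.δ) := by
  rw [PatchThickening.ptrack_apply, W.lift.apply_zero, b.planar_band_lowerLeft T W.δ_lt]

/-- The planar track of `K` at the end of the window is the corner `B = (1, -δ)`. [folklore] -/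
theorem x_one : T.ptrack K (φ 1) = pt2 1 (-b.δ) := by
  rw [PatchThickening.ptrack_apply, W.lift.apply_one]
  exact T.planar_apply_patch (b.closedSquare_subset_range_param T W.δ_lt
    (b.corner_mem_closedSquare (Or.inr rfl) (Or.inl rfl)))

/-- The planar track of `K' ∘ σ` at the start of the window is `A`. [folklore] -/
theorem x'_zero : W.x' (φ 0) = pt2 0 (-b.δ) := by
  have h := W.x'_eq (t := φ 0) ⟨by linarith [W.η_pos], by linarith [W.η_pos, W.lift.zero_lt_one]⟩
    (fun h ↦ lt_irrefl _ h.1)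
  rw [h, W.x_zero]

/-- The planar track of `K' ∘ σ` at the end of the window is `B`. [folklore] -/
theorem x'_one : W.x' (φ 1) = pt2 1 (-b.δ) := by
  have h := W.x'_eq (t := φ 1) ⟨by linarith [W.η_pos, W.lift.zero_lt_one], by linarith [W.η_pos]⟩
    (fun h ↦ lt_irrefl _ h.2)
  rw [h, W.x_one]

/-! ### Zones at the two ends of the window -/

/-- **Zone at `A`**: on a small initial segment `[φ 0, φ 0 + κ₃]` of the window, the planar
`x₁`-coordinates of the two tracks agree and are strictly increasing with positive derivative.
[folklore] -/
theorem exists_zoneA : ∃ κ₃ > 0, κ₃ < W.η ∧ 2 * κ₃ < φ 1 - φ 0 ∧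
    (∀ t ∈ Icc (φ 0) (φ 0 + κ₃), W.x' t 1 = T.ptrack K t 1) ∧
    StrictMonoOn (fun t ↦ T.ptrack K t 1) (Icc (φ 0) (φ 0 + κ₃)) ∧
    (∀ t ∈ Icc (φ 0) (φ 0 + κ₃), 0 < deriv (fun s ↦ T.ptrack K s 1) t ∧ 0 < deriv (fun s ↦ W.x' s 1) t) := by
  have hη := W.η_pos
  have h01 := W.lift.zero_lt_one
  have hpos : 0 < deriv (fun s ↦ T.ptrack K s 1) (φ 0) := b.deriv_planar_one_pos_left T W.δ_lt W.disjoint W.lift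
  have hc : ∀ t ∈ Ioo (φ 0 - W.η) (φ 1 + W.η), ContDiffAt ℝ ∞ (fun s ↦ T.ptrack K s 1) t := fun t ht ↦
    T.contDiffAt_planar_track_apply K (W.track_mem t ht).1 1
  have h0mem : φ 0 ∈ Ioo (φ 0 - W.η) (φ 1 + W.η) := ⟨by linarith, by linarith⟩
  obtain ⟨κa, hκa, hsub⟩ : ∃ κa > 0, Ioo (φ 0 - κa) (φ 0 + κa) ⊆ {t | 0 < deriv (fun s ↦ T.ptrack K s 1) t} := by
    obtain ⟨r, hr, h⟩ := Metric.mem_nhds_iff.1 (eventually_deriv_pos (hc _ h0mem) hpos)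
    exact ⟨r, hr, by rwa [Real.ball_eq_Ioo] at h⟩
  set κ₃ : ℝ := min (min W.η κa) (φ 1 - φ 0) / 4 with hκ₃
  have hm : 0 < min (min W.η κa) (φ 1 - φ 0) := lt_min (lt_min hη hκa) (by linarith)
  have hκ₃0 : 0 < κ₃ := by rw [hκ₃]; positivity
  have hκ₃η : 4 * κ₃ ≤ W.η := by
    have : min (min W.η κa) (φ 1 - φ 0) ≤ W.η := (min_le_left _ _).trans (min_le_left _ _); rw [hκ₃]; linarith
  have hκ₃a : 4 * κ₃ ≤ κa := by
    have : min (min W.η κa) (φ 1 - φ 0) ≤ κa := (min_le_left _ _).trans (min_le_right _ _); rw [hκ₃]; linarith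
  have hκ₃1 : 4 * κ₃ ≤ φ 1 - φ 0 := by
    have : min (min W.η κa) (φ 1 - φ 0) ≤ φ 1 - φ 0 := min_le_right _ _; rw [hκ₃]; linarith
  -- equality of the `x₁`-coordinates on the initial germ interval
  have heq : ∀ t ∈ Ioo (φ 0 - W.η) (φ 0 + W.η), W.x' t 1 = T.ptrack K t 1 := fun t ht ↦
    W.planar_one_eq t (Or.inl ht)
  refine ⟨κ₃, hκ₃0, by linarith, by linarith, fun t ht ↦ heq t ⟨by linarith [ht.1], by linarith [ht.2]⟩, ?_, ?_⟩
  · refine (strictMonoOn_of_deriv_pos (convex_Ioo (φ 0 - 4 * κ₃) (φ 0 + 4 * κ₃)) (fun t ht ↦ ?_)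
      (fun t ht ↦ ?_)).mono ?_
    · exact (hc t ⟨by linarith [ht.1], by linarith [ht.2]⟩).continuousAt.continuousWithinAt
    · exact hsub ⟨by linarith [(interior_subset ht).1], by linarith [(interior_subset ht).2]⟩
    · exact fun t ht ↦ ⟨by linarith [ht.1], by linarith [ht.2]⟩
  · intro t ht
    have htI : t ∈ Ioo (φ 0 - κa) (φ 0 + κa) := ⟨by linarith [ht.1], by linarith [ht.2]⟩
    have h1 : 0 < deriv (fun s ↦ T.ptrack K s 1) t := hsub htI
    refine ⟨h1, ?_⟩
    have hev : (fun s ↦ W.x' s 1) =ᶠ[𝓝 t] fun s ↦ T.ptrack K s 1 := by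
      filter_upwards [Ioo_mem_nhds (show φ 0 - W.η < t by linarith [ht.1]) (show t < φ 0 + W.η by linarith [ht.2])]
        with s hs using heq s hs
    rw [hev.deriv_eq]; exact h1

/-- **Zone at `B`**: on a small final segment `[φ 1 - κ₃, φ 1]` of the window, the planar
`x₁`-coordinates of the two tracks agree and are strictly decreasing with negative derivative.
[folklore] -/
theorem exists_zoneB : ∃ κ₃ > 0, κ₃ < W.η ∧ 2 * κ₃ < φ 1 - φ 0 ∧
    (∀ t ∈ Icc (φ 1 - κ₃) (φ 1), W.x' t 1 = T.ptrack K t 1) ∧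
    StrictAntiOn (fun t ↦ T.ptrack K t 1) (Icc (φ 1 - κ₃) (φ 1)) ∧
    (∀ t ∈ Icc (φ 1 - κ₃) (φ 1), deriv (fun s ↦ T.ptrack K s 1) t < 0 ∧ deriv (fun s ↦ W.x' s 1) t < 0) := by
  have hη := W.η_pos
  have h01 := W.lift.zero_lt_one
  have hneg : deriv (fun s ↦ T.ptrack K s 1) (φ 1) < 0 := b.deriv_planar_one_neg_right T W.δ_lt W.disjoint W.lift
  have hc : ∀ t ∈ Ioo (φ 0 - W.η) (φ 1 + W.η), ContDiffAt ℝ ∞ (fun s ↦ T.ptrack K s 1) t := fun t ht ↦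
    T.contDiffAt_planar_track_apply K (W.track_mem t ht).1 1
  have h1mem : φ 1 ∈ Ioo (φ 0 - W.η) (φ 1 + W.η) := ⟨by linarith, by linarith⟩
  obtain ⟨κa, hκa, hsub⟩ : ∃ κa > 0, Ioo (φ 1 - κa) (φ 1 + κa) ⊆ {t | deriv (fun s ↦ T.ptrack K s 1) t < 0} := by
    have hev : ∀ᶠ t in 𝓝 (φ 1), deriv (fun s ↦ T.ptrack K s 1) t < 0 :=
      (continuousAt_deriv_of_contDiffAt (hc _ h1mem)).eventually (gt_mem_nhds hneg)
    obtain ⟨r, hr, h⟩ := Metric.mem_nhds_iff.1 hev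
    exact ⟨r, hr, by rwa [Real.ball_eq_Ioo] at h⟩
  set κ₃ : ℝ := min (min W.η κa) (φ 1 - φ 0) / 4 with hκ₃
  have hm : 0 < min (min W.η κa) (φ 1 - φ 0) := lt_min (lt_min hη hκa) (by linarith)
  have hκ₃0 : 0 < κ₃ := by rw [hκ₃]; positivity
  have hκ₃η : 4 * κ₃ ≤ W.η := by
    have : min (min W.η κa) (φ 1 - φ 0) ≤ W.η := (min_le_left _ _).trans (min_le_left _ _); rw [hκ₃]; linarith
  have hκ₃a : 4 * κ₃ ≤ κa := by
    have : min (min W.η κa) (φ 1 - φ 0) ≤ κa := (min_le_left _ _).trans (min_le_right _ _); rw [hκ₃]; linarith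
  have hκ₃1 : 4 * κ₃ ≤ φ 1 - φ 0 := by
    have : min (min W.η κa) (φ 1 - φ 0) ≤ φ 1 - φ 0 := min_le_right _ _; rw [hκ₃]; linarith
  have heq : ∀ t ∈ Ioo (φ 1 - W.η) (φ 1 + W.η), W.x' t 1 = T.ptrack K t 1 := fun t ht ↦
    W.planar_one_eq t (Or.inr ht)
  refine ⟨κ₃, hκ₃0, by linarith, by linarith, fun t ht ↦ heq t ⟨by linarith [ht.1], by linarith [ht.2]⟩, ?_, ?_⟩
  · refine (strictAntiOn_of_deriv_neg (convex_Ioo (φ 1 - 4 * κ₃) (φ 1 + 4 * κ₃)) (fun t ht ↦ ?_)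
      (fun t ht ↦ ?_)).mono ?_
    · exact (hc t ⟨by linarith [ht.1], by linarith [ht.2]⟩).continuousAt.continuousWithinAt
    · exact hsub ⟨by linarith [(interior_subset ht).1], by linarith [(interior_subset ht).2]⟩
    · exact fun t ht ↦ ⟨by linarith [ht.1], by linarith [ht.2]⟩
  · intro t ht
    have htI : t ∈ Ioo (φ 1 - κa) (φ 1 + κa) := ⟨by linarith [ht.1], by linarith [ht.2]⟩
    have h1 : deriv (fun s ↦ T.ptrack K s 1) t < 0 := hsub htI
    refine ⟨h1, ?_⟩
    have hev : (fun s ↦ W.x' s 1) =ᶠ[𝓝 t] fun s ↦ T.ptrack K s 1 := by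
      filter_upwards [Ioo_mem_nhds (show φ 1 - W.η < t by linarith [ht.1]) (show t < φ 1 + W.η by linarith [ht.2])]
        with s hs using heq s hs
    rw [hev.deriv_eq]; exact h1

/-! ### Separation radii and near zones -/

/-- The planar homotopy of the two tracks is continuous on `[0, 1] × window`. [folklore] -/
theorem continuousOn_famX : ContinuousOn (fun q : ℝ × ℝ ↦ famX (T.ptrack K) W.x' q.1 q.2)
    (univ ×ˢ Icc (φ 0) (φ 1)) := by
  intro q hq
  have hq2 : q.2 ∈ Ioo (φ 0 - W.η) (φ 1 + W.η) := ⟨by linarith [hq.2.1, W.η_pos], by linarith [hq.2.2, W.η_pos]⟩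
  have hx : ContinuousAt (fun q : ℝ × ℝ ↦ T.ptrack K q.2) q := (W.contDiffAt_x hq2).continuousAt.comp continuousAt_snd
  have hx' : ContinuousAt (fun q : ℝ × ℝ ↦ W.x' q.2) q := (W.contDiffAt_x' hq2).continuousAt.comp continuousAt_snd
  have : (fun q : ℝ × ℝ ↦ famX (T.ptrack K) W.x' q.1 q.2) =
      fun q ↦ (1 - q.1) • T.ptrack K q.2 + q.1 • W.x' q.2 := by funext q; rfl
  rw [this]
  exact (((continuousAt_const.sub continuousAt_fst).smul hx).add (continuousAt_fst.smul hx')).continuousWithinAt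

/-- On the open window the planar homotopy avoids the bottom edge: its `x₁`-coordinate exceeds
`-δ`. [folklore] -/
theorem neg_delta_lt_famX_apply_one {u : ℝ} (hu : u ∈ Icc (0 : ℝ) 1) {t : ℝ} (ht : t ∈ Ioo (φ 0) (φ 1)) :
    -b.δ < famX (T.ptrack K) W.x' u t 1 := by
  have h1 := ((W.x_mem_of_mem_Ioo ht).1 1).1
  have h2 := ((W.x'_mem_of_mem_Ioo ht).1 1).1
  rw [famX_apply]
  rcases hu.1.eq_or_lt with h | h
  · rw [← h]; simpa using h1
  · nlinarith [mul_le_mul_of_nonneg_left h1.le (sub_nonneg.2 hu.2), mul_lt_mul_of_pos_left h2 h, hu.2]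

/-- **Far from `A`**: parameters in `[φ 0 + κ₃, φ 1]` have planar image at distance `≥ ρ > 0` from
`A` (a continuous positive function on a compact set). [folklore] -/
theorem exists_far_A {κ₃ : ℝ} (hκ₃ : 0 < κ₃) (hκ₃' : 2 * κ₃ < φ 1 - φ 0) :
    ∃ ρ > 0, ∀ u ∈ Icc (0 : ℝ) 1, ∀ t ∈ Icc (φ 0 + κ₃) (φ 1), ρ ≤ dist (famX (T.ptrack K) W.x' u t) (pt2 0 (-b.δ)) := by
  have hSc : IsCompact (Icc (0 : ℝ) 1 ×ˢ Icc (φ 0 + κ₃) (φ 1)) := isCompact_Icc.prod isCompact_Icc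
  have hSne : (Icc (0 : ℝ) 1 ×ˢ Icc (φ 0 + κ₃) (φ 1)).Nonempty :=
    ⟨(0, φ 1), ⟨left_mem_Icc.2 zero_le_one, right_mem_Icc.2 (by linarith)⟩⟩
  have hsub : Icc (0 : ℝ) 1 ×ˢ Icc (φ 0 + κ₃) (φ 1) ⊆ univ ×ˢ Icc (φ 0) (φ 1) :=
    prod_mono (subset_univ _) (Icc_subset_Icc (by linarith) le_rfl)
  have hfc : ContinuousOn (fun q : ℝ × ℝ ↦ ‖famX (T.ptrack K) W.x' q.1 q.2 - pt2 0 (-b.δ)‖)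
      (Icc (0 : ℝ) 1 ×ˢ Icc (φ 0 + κ₃) (φ 1)) :=
    ((W.continuousOn_famX.mono hsub).sub continuousOn_const).norm
  obtain ⟨q₀, hq₀, hmin⟩ := hSc.exists_isMinOn hSne hfc
  have hpos : 0 < ‖famX (T.ptrack K) W.x' q₀.1 q₀.2 - pt2 0 (-b.δ)‖ := by
    rw [norm_pos_iff, sub_ne_zero]
    intro heq
    rcases hq₀.2.2.eq_or_lt with h2 | h2
    · rw [h2, famX_eq_of_eq (by rw [W.x'_one, W.x_one]), W.x_one] at heq
      have h0 : (pt2 1 (-b.δ) : 𝔼 2) 0 = (pt2 0 (-b.δ) : 𝔼 2) 0 := by rw [heq]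
      rw [pt2_apply_zero, pt2_apply_zero] at h0
      exact one_ne_zero h0
    · have hlt := W.neg_delta_lt_famX_apply_one hq₀.1 ⟨by linarith [hq₀.2.1], h2⟩
      rw [heq, pt2_apply_one] at hlt
      exact lt_irrefl _ hlt
  refine ⟨_, hpos, fun u hu t ht ↦ ?_⟩
  rw [dist_eq_norm]
  exact (isMinOn_iff.1 hmin) (u, t) (show (u, t) ∈ Icc (0 : ℝ) 1 ×ˢ Icc (φ 0 + κ₃) (φ 1) from ⟨hu, ht⟩)

/-- **Far from `B`**: parameters in `[φ 0, φ 1 - κ₃]` have planar image at distance `≥ ρ' > 0`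
from `B`. [folklore] -/
theorem exists_far_B {κ₃ : ℝ} (hκ₃ : 0 < κ₃) (hκ₃' : 2 * κ₃ < φ 1 - φ 0) :
    ∃ ρ > 0, ∀ u ∈ Icc (0 : ℝ) 1, ∀ t ∈ Icc (φ 0) (φ 1 - κ₃), ρ ≤ dist (famX (T.ptrack K) W.x' u t) (pt2 1 (-b.δ)) := by
  have hSc : IsCompact (Icc (0 : ℝ) 1 ×ˢ Icc (φ 0) (φ 1 - κ₃)) := isCompact_Icc.prod isCompact_Icc
  have hSne : (Icc (0 : ℝ) 1 ×ˢ Icc (φ 0) (φ 1 - κ₃)).Nonempty :=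
    ⟨(0, φ 0), ⟨left_mem_Icc.2 zero_le_one, left_mem_Icc.2 (by linarith)⟩⟩
  have hsub : Icc (0 : ℝ) 1 ×ˢ Icc (φ 0) (φ 1 - κ₃) ⊆ univ ×ˢ Icc (φ 0) (φ 1) :=
    prod_mono (subset_univ _) (Icc_subset_Icc le_rfl (by linarith))
  have hfc : ContinuousOn (fun q : ℝ × ℝ ↦ ‖famX (T.ptrack K) W.x' q.1 q.2 - pt2 1 (-b.δ)‖)
      (Icc (0 : ℝ) 1 ×ˢ Icc (φ 0) (φ 1 - κ₃)) :=
    ((W.continuousOn_famX.mono hsub).sub continuousOn_const).norm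
  obtain ⟨q₀, hq₀, hmin⟩ := hSc.exists_isMinOn hSne hfc
  have hpos : 0 < ‖famX (T.ptrack K) W.x' q₀.1 q₀.2 - pt2 1 (-b.δ)‖ := by
    rw [norm_pos_iff, sub_ne_zero]
    intro heq
    rcases hq₀.2.1.eq_or_lt with h2 | h2
    · rw [← h2, famX_eq_of_eq (by rw [W.x'_zero, W.x_zero]), W.x_zero] at heq
      have h0 : (pt2 0 (-b.δ) : 𝔼 2) 0 = (pt2 1 (-b.δ) : 𝔼 2) 0 := by rw [heq]
      rw [pt2_apply_zero, pt2_apply_zero] at h0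
      exact zero_ne_one h0
    · have hlt := W.neg_delta_lt_famX_apply_one hq₀.1 ⟨h2, by linarith [hq₀.2.2]⟩
      rw [heq, pt2_apply_one] at hlt
      exact lt_irrefl _ hlt
  refine ⟨_, hpos, fun u hu t ht ↦ ?_⟩
  rw [dist_eq_norm]
  exact (isMinOn_iff.1 hmin) (u, t) (show (u, t) ∈ Icc (0 : ℝ) 1 ×ˢ Icc (φ 0) (φ 1 - κ₃) from ⟨hu, ht⟩)

/-- **Near `A`**: given `ρ > 0`, parameters in a small initial segment have planar image within `ρ`
of `A` (both tracks are continuous at `φ 0` with value `A`, and balls are convex). [folklore] -/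
theorem exists_near_A {ρ : ℝ} (hρ : 0 < ρ) :
    ∃ κ₁ > 0, ∀ u ∈ Icc (0 : ℝ) 1, ∀ t ∈ Icc (φ 0) (φ 0 + κ₁), dist (famX (T.ptrack K) W.x' u t) (pt2 0 (-b.δ)) < ρ := by
  have hη := W.η_pos
  have h01 := W.lift.zero_lt_one
  have h0mem : φ 0 ∈ Ioo (φ 0 - W.η) (φ 1 + W.η) := ⟨by linarith, by linarith⟩
  have hcx : ContinuousAt (T.ptrack K) (φ 0) := (W.contDiffAt_x h0mem).continuousAt
  have hcx' : ContinuousAt W.x' (φ 0) := (W.contDiffAt_x' h0mem).continuousAt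
  obtain ⟨d₁, hd₁, h₁⟩ := Metric.continuousAt_iff.1 hcx ρ hρ
  obtain ⟨d₂, hd₂, h₂⟩ := Metric.continuousAt_iff.1 hcx' ρ hρ
  have hm : 0 < min d₁ d₂ := lt_min hd₁ hd₂
  refine ⟨min d₁ d₂ / 2, by positivity, fun u hu t ht ↦ ?_⟩
  have hdt : dist t (φ 0) < min d₁ d₂ := by
    rw [Real.dist_eq, abs_of_nonneg (show 0 ≤ t - φ 0 by linarith [ht.1])]; linarith [ht.2]
  have hx : T.ptrack K t ∈ ball (pt2 0 (-b.δ)) ρ := by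
    rw [mem_ball, ← W.x_zero]; exact h₁ (lt_of_lt_of_le hdt (min_le_left _ _))
  have hx' : W.x' t ∈ ball (pt2 0 (-b.δ)) ρ := by
    rw [mem_ball, ← W.x'_zero]; exact h₂ (lt_of_lt_of_le hdt (min_le_right _ _))
  exact (convex_ball _ _).segment_subset hx hx' (famX_mem_segment hu t)

/-- **Near `B`**: given `ρ > 0`, parameters in a small final segment have planar image within `ρ`
of `B`. [folklore] -/
theorem exists_near_B {ρ : ℝ} (hρ : 0 < ρ) :
    ∃ κ₁ > 0, ∀ u ∈ Icc (0 : ℝ) 1, ∀ t ∈ Icc (φ 1 - κ₁) (φ 1), dist (famX (T.ptrack K) W.x' u t) (pt2 1 (-b.δ)) < ρ := by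
  have hη := W.η_pos
  have h01 := W.lift.zero_lt_one
  have h1mem : φ 1 ∈ Ioo (φ 0 - W.η) (φ 1 + W.η) := ⟨by linarith, by linarith⟩
  have hcx : ContinuousAt (T.ptrack K) (φ 1) := (W.contDiffAt_x h1mem).continuousAt
  have hcx' : ContinuousAt W.x' (φ 1) := (W.contDiffAt_x' h1mem).continuousAt
  obtain ⟨d₁, hd₁, h₁⟩ := Metric.continuousAt_iff.1 hcx ρ hρ
  obtain ⟨d₂, hd₂, h₂⟩ := Metric.continuousAt_iff.1 hcx' ρ hρ
  have hm : 0 < min d₁ d₂ := lt_min hd₁ hd₂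
  refine ⟨min d₁ d₂ / 2, by positivity, fun u hu t ht ↦ ?_⟩
  have hdt : dist t (φ 1) < min d₁ d₂ := by
    rw [Real.dist_eq, abs_of_nonpos (show t - φ 1 ≤ 0 by linarith [ht.2])]; linarith [ht.1]
  have hx : T.ptrack K t ∈ ball (pt2 1 (-b.δ)) ρ := by
    rw [mem_ball, ← W.x_one]; exact h₁ (lt_of_lt_of_le hdt (min_le_left _ _))
  have hx' : W.x' t ∈ ball (pt2 1 (-b.δ)) ρ := by
    rw [mem_ball, ← W.x'_one]; exact h₂ (lt_of_lt_of_le hdt (min_le_right _ _))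
  exact (convex_ball _ _).segment_subset hx hx' (famX_mem_segment hu t)

/-! ### Proximity to the attaching points in `𝕊³` -/

omit W in
/-- **Points of the thickening over parameters near a point `x₀` of the parameter domain, at small
height, are near the band point `band x₀`** (continuity of `(x, h) ↦ emb (paramInv x, h)` at
`(x₀, 0)`). [folklore] -/
theorem exists_emb_near {x₀ : 𝔼 2} (hx₀ : x₀ ∈ range T.param) {r : ℝ} (hr : 0 < r) :
    ∃ ρ > 0, ∀ (X : 𝔼 2) (Z : 𝔼 1), X ∈ range T.param → dist X x₀ < ρ → ‖Z‖ < ρ →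
      dist (T.emb (slabEquiv.symm (T.paramInv X, Z))) (b.band x₀) < r := by
  set G : (𝔼 2) × 𝔼 1 → 𝕊 3 := fun q ↦ T.emb (slabEquiv.symm (T.paramInv q.1, q.2)) with hG
  have hGc : ContinuousAt G (x₀, 0) := by
    have h1 : ContinuousAt (fun q : (𝔼 2) × 𝔼 1 ↦ (T.paramInv q.1, q.2)) (x₀, 0) :=
      ((T.contDiffAt_paramInv hx₀).continuousAt.comp continuousAt_fst).prodMk continuousAt_snd
    exact (T.isSmoothEmbedding.contMDiff.continuous.continuousAt.comp
      (slabEquiv.symm.continuous.continuousAt)).comp h1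
  have hG0 : G (x₀, 0) = b.band x₀ := by
    simp only [hG]
    rw [T.emb_inl, T.param_paramInv hx₀]
  have hmem : G ⁻¹' ball (b.band x₀) r ∈ 𝓝 ((x₀, (0 : 𝔼 1)) : (𝔼 2) × 𝔼 1) :=
    hGc.preimage_mem_nhds (by rw [hG0]; exact ball_mem_nhds _ hr)
  obtain ⟨U, hU, V, hV, hUV⟩ := mem_nhds_prod_iff.1 hmem
  obtain ⟨ρ₁, hρ₁, hU₁⟩ := Metric.mem_nhds_iff.1 hU
  obtain ⟨ρ₂, hρ₂, hV₂⟩ := Metric.mem_nhds_iff.1 hV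
  refine ⟨min ρ₁ ρ₂, lt_min hρ₁ hρ₂, fun X Z _ hX hZ ↦ ?_⟩
  have hXU : X ∈ U := hU₁ (mem_ball.2 (lt_of_lt_of_le hX (min_le_left _ _)))
  have hZV : Z ∈ V := hV₂ (by rw [mem_ball, dist_zero_right]; exact lt_of_lt_of_le hZ (min_le_right _ _))
  have hmem' : (X, Z) ∈ G ⁻¹' ball (b.band x₀) r := hUV (mk_mem_prod hXU hZV)
  rw [mem_preimage, mem_ball] at hmem'
  exact hmem'

/-! ### The height of the rest of `K` over a compact planar set in the lower half -/

/-- Parameters not mapping to the open lower arc are, modulo the period, in `[φ 1 - 1, φ 0]`.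
[folklore] -/
theorem exists_mem_Icc_of_not_mem {t : ℝ} (ht : K (circlePt t) ∉ b.lowerCurve '' Ioo 0 1) :
    ∃ t' ∈ Icc (φ 1 - 1) (φ 0), K (circlePt t') = K (circlePt t) := by
  set t' : ℝ := t - ⌊t - (φ 1 - 1)⌋ with ht'
  have hKt : K (circlePt t') = K (circlePt t) := by
    rw [ht', show t - (⌊t - (φ 1 - 1)⌋ : ℝ) = t + ((-⌊t - (φ 1 - 1)⌋ : ℤ) : ℝ) by push_cast; ring, circlePt_add_int]
  have hI : t' ∈ Ico (φ 1 - 1) (φ 1) := by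
    have h1 := Int.floor_le (t - (φ 1 - 1))
    have h2 := Int.lt_floor_add_one (t - (φ 1 - 1))
    constructor <;> simp only [ht'] <;> linarith
  refine ⟨t', ⟨hI.1, ?_⟩, hKt⟩
  by_contra hcon
  push Not at hcon
  apply ht
  rw [← hKt]
  exact b.apply_circlePt_mem_lowerCurve_image W.lift.continuous W.lift.strictMonoOn W.lift.2.2 ⟨hcon, hI.2⟩

omit W in
/-- The rest of `K` (off the open lower arc) is the image of the compact parameter set
`[φ 1 - 1, φ 0]`. [folklore] -/
theorem isCompact_rest (K : Knot) (φ : ℝ → ℝ) : IsCompact ((fun t ↦ K (circlePt t)) '' Icc (φ 1 - 1) (φ 0)) :=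
  isCompact_Icc.image (K.continuous.comp continuous_circlePt)

/-- A point of the rest of `K` in the band surface lies on the open upper arc: its planar coordinate
has `x₁ > 1/2`. [folklore] -/
theorem half_lt_planar_of_rest_mem_support {t' : ℝ} (ht' : t' ∈ Icc (φ 1 - 1) (φ 0))
    (hsupp : K (circlePt t') ∈ b.support) : 2⁻¹ < T.planar (K (circlePt t')) 1 := by
  obtain ⟨q, hq, hqe⟩ := hsupp
  have hmem : q ∈ b.band ⁻¹' range K ∩ squareNhd b.δ := ⟨⟨_, hqe.symm⟩, hq⟩
  rw [b.preimage_range] at hmem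
  have hcl := b.injOn_band_closedSquare T W.δ_lt
  rcases hmem with ⟨s, hs, rfl⟩ | ⟨s, hs, rfl⟩
  · -- on the open lower arc: impossible for these parameters
    exfalso
    have h1 : K (circlePt t') ∈ b.lowerCurve '' Icc 0 1 := ⟨s, Ioo_subset_Icc_self hs, hqe⟩
    rcases ht'.2.eq_or_lt with h2 | h2
    · rw [h2, W.lift.apply_zero] at hqe
      have := hcl (b.lowerArc_mem_closedSquare (Ioo_subset_Icc_self hs))
        (b.corner_mem_closedSquare (Or.inl rfl) (Or.inl rfl)) hqe
      exact b.lowerArc_ne_lowerLeft ⟨hs.1, hs.2.le⟩ this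
    rcases ht'.1.eq_or_lt with h3 | h3
    · rw [← h3, show φ 1 - 1 = φ 1 + ((-1 : ℤ) : ℝ) by push_cast; ring, circlePt_add_int, W.lift.apply_one] at hqe
      have := hcl (b.lowerArc_mem_closedSquare (Ioo_subset_Icc_self hs))
        (b.corner_mem_closedSquare (Or.inr rfl) (Or.inl rfl)) hqe
      have h0 : (b.lowerArc s) 1 = (pt2 1 (-b.δ) : 𝔼 2) 1 := by rw [this]
      rw [pt2_apply_one] at h0
      exact (lt_irrefl _ (h0 ▸ ((b.lowerArc_mem s hs).1 1).1))
    exact K.apply_circlePt_not_mem_image_Icc_of_mem_Ioo_left W.lift.continuous.continuousOn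
      (W.lift.strictMonoOn.mono Ioo_subset_Icc_self) W.lift.2.2 ⟨h3, h2⟩ h1
  · rw [← hqe, T.planar_apply_patch (b.closedSquare_subset_range_param T W.δ_lt
      (b.upperArc_mem_closedSquare (Ioo_subset_Icc_self hs)))]
    exact (b.upperArc_mem s hs).2

/-- **The rest of `K` keeps a positive height over any compact planar set in the open lower half.**
If `Q ⊆ {x ∈ squareNhd δ | x₁ < 1/2}` is compact, there is `h₀ > 0` such that every point of `K`
off the open lower arc, in the image of the thickening with planar coordinate in `Q` and height
at most `1`, has height `≥ h₀`: such points form a compact set on which the height does not vanish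
(a point of height `0` over `Q` is in the band surface, hence on the open upper arc, where
`x₁ > 1/2`). [folklore] -/
theorem exists_height_bound {Q : Set (𝔼 2)} (hQc : IsCompact Q) (hQ : Q ⊆ {x | x ∈ squareNhd b.δ ∧ x 1 < 2⁻¹}) :
    ∃ h₀ > 0, ∀ t : ℝ, K (circlePt t) ∉ b.lowerCurve '' Ioo 0 1 → K (circlePt t) ∈ range T.emb →
      T.planar (K (circlePt t)) ∈ Q → ‖T.height (K (circlePt t))‖ ≤ 1 → h₀ ≤ ‖T.height (K (circlePt t))‖ := by
  have hQσ : Q ⊆ range T.param := fun x hx ↦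
    T.squareNhd_subset (squareNhd_mono W.δ_lt.le (hQ hx).1)
  set E : Set (𝕊 3) := (fun q : (𝔼 2) × 𝔼 1 ↦ T.emb (slabEquiv.symm q)) '' ((T.paramInv '' Q) ×ˢ closedBall (0 : 𝔼 1) 1)
    with hE
  have hEc : IsCompact E :=
    ((hQc.image_of_continuousOn (T.contDiffOn_paramInv.continuousOn.mono hQσ)).prod (isCompact_closedBall 0 1)).image
      (T.isSmoothEmbedding.contMDiff.continuous.comp slabEquiv.symm.continuous)
  set F : Set (𝕊 3) := (fun t ↦ K (circlePt t)) '' Icc (φ 1 - 1) (φ 0) ∩ E with hF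
  have hFc : IsCompact F := (isCompact_rest K φ).inter_right hEc.isClosed
  have hFE : F ⊆ range T.emb := by
    rintro c ⟨-, q, -, rfl⟩; exact mem_range_self _
  -- the height does not vanish on `F`
  have hne : ∀ c ∈ F, T.height c ≠ 0 := by
    rintro c ⟨⟨t', ht', rfl⟩, ⟨y, h⟩, ⟨⟨x, hxQ, rfl⟩, -⟩, hq⟩ h0
    simp only at hq
    have hh : T.height (K (circlePt t')) = h := by rw [← hq, T.height_emb]
    rw [hh] at h0
    subst h0
    have hpt : K (circlePt t') = b.band x := by
      rw [← hq, T.emb_inl, T.param_paramInv (hQσ hxQ)]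
    have hsupp : K (circlePt t') ∈ b.support := ⟨x, (hQ hxQ).1, hpt.symm⟩
    have h1 := W.half_lt_planar_of_rest_mem_support ht' hsupp
    rw [hpt, T.planar_apply_patch (hQσ hxQ)] at h1
    linarith [(hQ hxQ).2]
  -- a positive lower bound on the compact `F`
  have hcont : ContinuousOn (fun c ↦ ‖T.height c‖) F := by
    refine ContinuousOn.norm ?_
    refine ContinuousOn.mono ?_ hFE
    intro c hc
    have h1 : ContinuousAt T.chart c := (T.contMDiffAt_chart hc).continuousAt
    exact ((continuous_snd.comp slabEquiv.continuous).continuousAt.comp h1).continuousWithinAt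
  by_cases hFne : F.Nonempty
  · obtain ⟨c₀, hc₀, hmin⟩ := hFc.exists_isMinOn hFne hcont
    refine ⟨‖T.height c₀‖, norm_pos_iff.2 (hne c₀ hc₀), fun t ht hmem hQt hle ↦ (isMinOn_iff.1 hmin) _ ⟨?_, ?_⟩⟩
    · obtain ⟨t', ht', heq⟩ := W.exists_mem_Icc_of_not_mem ht
      exact ⟨t', ht', heq⟩
    · refine ⟨(T.paramInv (T.planar (K (circlePt t))), T.height (K (circlePt t))), ⟨⟨_, hQt, rfl⟩, ?_⟩, ?_⟩
      · rwa [mem_closedBall, dist_zero_right]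
      · exact T.emb_paramInv_planar hmem
  · refine ⟨1, one_pos, fun t ht hmem hQt hle ↦ ?_⟩
    exfalso
    apply hFne
    obtain ⟨t', ht', heq⟩ := W.exists_mem_Icc_of_not_mem ht
    refine ⟨K (circlePt t), ⟨t', ht', heq⟩, (T.paramInv (T.planar (K (circlePt t))), T.height (K (circlePt t))),
      ⟨⟨_, hQt, rfl⟩, ?_⟩, T.emb_paramInv_planar hmem⟩
    rwa [mem_closedBall, dist_zero_right]

end WindowMatching

end BandData

/-! ## Derivative lemmas -/

section DerivLemmas

variable {F : Type*} [NormedAddCommGroup F] [NormedSpace ℝ F]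

/-- A function which is differentiable at `a` and constant on a left neighbourhood `(a - ε, a]` has
derivative zero at `a` (companion of `deriv_eq_zero_of_eventuallyEq_const_Ici`). [folklore] -/
theorem deriv_eq_zero_of_eventuallyEq_const_Iic {f : ℝ → F} {a : ℝ} {c : F} (hf : DifferentiableAt ℝ f a)
    (h : ∀ᶠ t in 𝓝[Iic a] a, f t = c) : deriv f a = 0 := by
  rw [← hf.derivWithin (uniqueDiffWithinAt_Iic a)]
  have hfa : f a = c := h.self_of_nhdsWithin (mem_Iic.2 le_rfl)
  rw [EventuallyEq.derivWithin_eq (show f =ᶠ[𝓝[Iic a] a] fun _ ↦ c from h) (by simp [hfa])]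
  simp

/-- A function vanishing on `[a, c]` (`a < c`) and differentiable at a point of `[a, c]` has
derivative zero there. [folklore] -/
theorem deriv_eq_zero_of_eqOn_Icc {f : ℝ → F} {a c t : ℝ} (hac : a < c) (ht : t ∈ Icc a c)
    (hf : ∀ s ∈ Icc a c, f s = 0) (hd : DifferentiableAt ℝ f t) : deriv f t = 0 := by
  rcases ht.2.eq_or_lt with rfl | hlt
  · refine deriv_eq_zero_of_eventuallyEq_const_Iic (c := 0) hd ?_
    filter_upwards [Icc_mem_nhdsLE hac] with s hs using hf s hs
  · refine deriv_eq_zero_of_eventuallyEq_const_Ici (c := 0) hd ?_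
    filter_upwards [Icc_mem_nhdsGE hlt] with s hs using hf s ⟨ht.1.trans hs.1, hs.2⟩

end DerivLemmas

namespace PatchThickening

variable {β : 𝔼 2 → 𝕊 3} {δ₀ δ₁ : ℝ} (T : PatchThickening β δ₀ δ₁)

/-- **The planar track of a knot is regular where its height track vanishes on an interval**: if
`htrack L = 0` on `[a, c]` then `deriv (ptrack L) t ≠ 0` for `t ∈ [a, c]` (the chart track is
regular and `param` is an immersion, `deriv_eq_zero_of_slab`). [folklore] -/
theorem deriv_ptrack_ne_zero (L : Knot) {a c t : ℝ} (hac : a < c) (ht : t ∈ Icc a c)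
    (hmem : L (circlePt t) ∈ range T.emb) (hh : ∀ s ∈ Icc a c, T.htrack L s = 0) :
    deriv (T.ptrack L) t ≠ 0 := by
  intro h0
  have hd : DifferentiableAt ℝ (fun s ↦ T.chart (L (circlePt s))) t :=
    (T.contDiffAt_chart_track L hmem).differentiableAt (by simp)
  have hz : deriv (T.htrack L) t = 0 :=
    deriv_eq_zero_of_eqOn_Icc hac ht hh ((T.contDiffAt_height_track L hmem).differentiableAt (by simp))
  exact T.deriv_chart_track_ne_zero L hmem (T.deriv_eq_zero_of_slab hd h0 hz)

/-- The thickening read in `ℝ⁴` has injective differential (the chart is a smooth left inverse of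
`emb`, and `𝕊³ ⊆ ℝ⁴` is an immersion). [folklore] -/
theorem injective_fderiv_coe_emb (w : 𝔼 3) :
    Injective (fderiv ℝ (fun w : 𝔼 3 ↦ ((T.emb w : 𝕊 3) : 𝔼 4)) w) := by
  have hval : ContMDiff (𝓡 3) 𝓘(ℝ, 𝔼 4) ∞ (Subtype.val : (𝕊 3) → 𝔼 4) := contMDiff_coe_sphere
  have hvd : MDifferentiableAt (𝓡 3) 𝓘(ℝ, 𝔼 4) (Subtype.val : (𝕊 3) → 𝔼 4) (T.emb w) :=
    hval.contMDiffAt.mdifferentiableAt (by simp)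
  have hed : MDifferentiableAt 𝓘(ℝ, 𝔼 3) (𝓡 3) T.emb w :=
    T.isSmoothEmbedding.contMDiff.contMDiffAt.mdifferentiableAt (by simp)
  have hchain : mfderiv 𝓘(ℝ, 𝔼 3) 𝓘(ℝ, 𝔼 4) ((Subtype.val : (𝕊 3) → 𝔼 4) ∘ T.emb) w =
      (mfderiv (𝓡 3) 𝓘(ℝ, 𝔼 4) (Subtype.val : (𝕊 3) → 𝔼 4) (T.emb w)).comp (mfderiv 𝓘(ℝ, 𝔼 3) (𝓡 3) T.emb w) :=
    mfderiv_comp w hvd hed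
  have h1 : Injective (mfderiv (𝓡 3) 𝓘(ℝ, 𝔼 4) (Subtype.val : (𝕊 3) → 𝔼 4) (T.emb w)) :=
    mfderiv_coe_sphere_injective (T.emb w)
  have h2 : Injective (mfderiv 𝓘(ℝ, 𝔼 3) (𝓡 3) T.emb w) := by
    have hcd : MDifferentiableAt (𝓡 3) 𝓘(ℝ, 𝔼 3) T.chart (T.emb w) :=
      (T.contMDiffAt_chart (mem_range_self w)).mdifferentiableAt (by simp)
    have hcomp : mfderiv 𝓘(ℝ, 𝔼 3) 𝓘(ℝ, 𝔼 3) (T.chart ∘ T.emb) w =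
        (mfderiv (𝓡 3) 𝓘(ℝ, 𝔼 3) T.chart (T.emb w)).comp (mfderiv 𝓘(ℝ, 𝔼 3) (𝓡 3) T.emb w) :=
      mfderiv_comp w hcd hed
    have hid : (T.chart : (𝕊 3) → 𝔼 3) ∘ T.emb = id := funext fun v ↦ T.chart_emb v
    rw [hid, mfderiv_id] at hcomp
    intro v v' hvv'
    have := congrArg (mfderiv (𝓡 3) 𝓘(ℝ, 𝔼 3) T.chart (T.emb w)) hvv'
    rw [← ContinuousLinearMap.comp_apply, ← ContinuousLinearMap.comp_apply, ← hcomp] at this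
    exact this
  rw [← mfderiv_eq_fderiv, show (fun w : 𝔼 3 ↦ ((T.emb w : 𝕊 3) : 𝔼 4)) = (Subtype.val : (𝕊 3) → 𝔼 4) ∘ T.emb
    from rfl, hchain]
  exact h1.comp h2

/-- `slabMap` has injective differential. [folklore] -/
theorem injective_fderiv_slabMap (q : (𝔼 2) × 𝔼 1) : Injective (fderiv ℝ T.slabMap q) := by
  have hd : DifferentiableAt ℝ (fun w : 𝔼 3 ↦ ((T.emb w : 𝕊 3) : 𝔼 4)) (slabEquiv.symm q) :=
    T.contDiff_coe_emb.differentiable (by simp) _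
  have : fderiv ℝ T.slabMap q = (fderiv ℝ (fun w : 𝔼 3 ↦ ((T.emb w : 𝕊 3) : 𝔼 4)) (slabEquiv.symm q)).comp
      ((slabEquiv.symm : ((𝔼 2) × 𝔼 1) ≃L[ℝ] 𝔼 3) : ((𝔼 2) × 𝔼 1) →L[ℝ] 𝔼 3) := by
    rw [show T.slabMap = (fun w : 𝔼 3 ↦ ((T.emb w : 𝕊 3) : 𝔼 4)) ∘ slabEquiv.symm from rfl,
      fderiv_comp q hd (slabEquiv.symm : ((𝔼 2) × 𝔼 1) ≃L[ℝ] 𝔼 3).differentiableAt,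
      ContinuousLinearEquiv.fderiv]
  rw [this]
  exact (T.injective_fderiv_coe_emb _).comp (slabEquiv.symm : ((𝔼 2) × 𝔼 1) ≃L[ℝ] 𝔼 3).injective

/-- `paramInv` has injective differential on the image of `param` (`param` is a smooth left
inverse there). [folklore] -/
theorem injective_fderiv_paramInv {x : 𝔼 2} (hx : x ∈ range T.param) : Injective (fderiv ℝ T.paramInv x) := by
  have hev : (T.param ∘ T.paramInv) =ᶠ[𝓝 x] id := by
    filter_upwards [T.isOpen_range_param.mem_nhds hx] with y hy using T.param_paramInv hy
  have hd1 : DifferentiableAt ℝ T.paramInv x := (T.contDiffAt_paramInv hx).differentiableAt (by simp)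
  have hd2 : DifferentiableAt ℝ T.param (T.paramInv x) := T.contDiff_param.differentiable (by simp) _
  have hcomp : fderiv ℝ (T.param ∘ T.paramInv) x = (fderiv ℝ T.param (T.paramInv x)).comp (fderiv ℝ T.paramInv x) :=
    fderiv_comp x hd2 hd1
  rw [hev.fderiv_eq, fderiv_id] at hcomp
  intro v v' h
  have := congrArg (fderiv ℝ T.param (T.paramInv x)) h
  rw [← ContinuousLinearMap.comp_apply, ← ContinuousLinearMap.comp_apply, ← hcomp] at this
  exact this

end PatchThickening

namespace BandData

namespace WindowMatching

variable {K₁ K₂ K K' : Knot} {avoid avoid' : Set (𝕊 3)} {b : BandData K₁ K₂ K avoid}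
  {b' : BandData K₁ K₂ K' avoid'} {δ₀ δ₁ : ℝ} {T : PatchThickening b.band δ₀ δ₁} {φ φ' : ℝ → ℝ}
  (W : WindowMatching b b' T φ φ')
include W

/-! ### Regularity of the stages on the window -/

/-- The planar track of `K` is regular on the window. [folklore] -/
theorem deriv_x_ne_zero {t : ℝ} (ht : t ∈ Icc (φ 0) (φ 1)) : deriv (T.ptrack K) t ≠ 0 := by
  have hη := W.η_pos
  refine T.deriv_ptrack_ne_zero K W.lift.zero_lt_one ht (W.track_mem t ⟨by linarith [ht.1], by linarith [ht.2]⟩).1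
    fun s hs ↦ (W.x_mem hs).2.2

/-- The planar track of `K' ∘ σ` is regular on the window. [folklore] -/
theorem deriv_x'_ne_zero {t : ℝ} (ht : t ∈ Icc (φ 0) (φ 1)) : deriv W.x' t ≠ 0 := by
  have hη := W.η_pos
  have hts : t ∈ Ioo (φ 0 - W.η) (φ 1 + W.η) := ⟨by linarith [ht.1], by linarith [ht.2]⟩
  -- the planar track of `K'` is regular on its own window
  obtain ⟨T', hT'e, -, -, hT'p, hT'h⟩ := PatchThickening.exists_cast W.band_eq T
  have hδ₁' : b'.δ < δ₁ := W.δ_eq ▸ W.δ_lt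
  have hσt : W.σ t ∈ Icc (φ' 0) (φ' 1) := W.mapsTo ht
  have hmem' : K' (circlePt (W.σ t)) ∈ range T.emb := (W.track_mem t hts).2
  have hh' : ∀ s ∈ Icc (φ' 0) (φ' 1), T.htrack K' s = 0 := by
    intro s hs
    obtain ⟨-, -, -, -, -, -, hh, -⟩ := W.lift'.track_of_mem T' hδ₁' hs
    rw [PatchThickening.htrack_apply, ← hT'h]; exact hh
  have h1 : deriv (T.ptrack K') (W.σ t) ≠ 0 := T.deriv_ptrack_ne_zero K' W.lift'.zero_lt_one hσt hmem' hh'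
  -- chain rule
  have hd : DifferentiableAt ℝ (T.ptrack K') (W.σ t) := (T.contDiffAt_planar_track K' hmem').differentiableAt (by simp)
  have hσd : DifferentiableAt ℝ W.σ t := (W.smooth t hts).1.differentiableAt (by simp)
  rw [show W.x' = T.ptrack K' ∘ W.σ from rfl, deriv.scomp t hd hσd]
  exact smul_ne_zero (W.smooth t hts).2.ne' h1

/-- The height tracks have derivative zero on the window. [folklore] -/
theorem deriv_z_eq_zero {t : ℝ} (ht : t ∈ Icc (φ 0) (φ 1)) : deriv (T.htrack K) t = 0 ∧ deriv W.z' t = 0 := by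
  have hη := W.η_pos
  have hts : t ∈ Ioo (φ 0 - W.η) (φ 1 + W.η) := ⟨by linarith [ht.1], by linarith [ht.2]⟩
  exact ⟨deriv_eq_zero_of_eqOn_Icc W.lift.zero_lt_one ht (fun s hs ↦ (W.x_mem hs).2.2)
      ((W.contDiffAt_z hts).differentiableAt (by simp)),
    deriv_eq_zero_of_eqOn_Icc W.lift.zero_lt_one ht (fun s hs ↦ (W.x'_mem hs).2.2)
      ((W.contDiffAt_z' hts).differentiableAt (by simp))⟩

/-- **Regularity transfer**: on the window, if the lifted two-arc family (at the clamped parameter)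
is regular at `t` then so is the stage of `fam` (the thickening has injective differential,
`paramInv` too, and the height tracks are stationary on the window). [folklore] -/
theorem deriv_fam_ne_zero_of {κ c u t : ℝ} (ht : t ∈ Icc (φ 0) (φ 1))
    (hlift : deriv (liftFam (T.ptrack K) W.x' (windowBump φ κ) c hUnit (clamp01 u)) t ≠ 0) :
    deriv (W.fam κ c u) t ≠ 0 := by
  have hη := W.η_pos
  have hts : t ∈ Ioo (φ 0 - W.η) (φ 1 + W.η) := ⟨by linarith [ht.1], by linarith [ht.2]⟩
  -- derivatives of the constituents
  have hxd : HasDerivAt (T.ptrack K) (deriv (T.ptrack K) t) t :=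
    ((W.contDiffAt_x hts).differentiableAt (by simp)).hasDerivAt
  have hxd' : HasDerivAt W.x' (deriv W.x' t) t := ((W.contDiffAt_x' hts).differentiableAt (by simp)).hasDerivAt
  have hzd : HasDerivAt (T.htrack K) 0 t := by
    have := ((W.contDiffAt_z hts).differentiableAt (by simp)).hasDerivAt; rwa [(W.deriv_z_eq_zero ht).1] at this
  have hzd' : HasDerivAt W.z' 0 t := by
    have := ((W.contDiffAt_z' hts).differentiableAt (by simp)).hasDerivAt; rwa [(W.deriv_z_eq_zero ht).2] at this
  have hζd : HasDerivAt (windowBump φ κ) (deriv (windowBump φ κ) t) t :=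
    ((contDiff_windowBump φ κ).differentiable (by simp) t).hasDerivAt
  -- the planar and height parts
  have hX : HasDerivAt (W.planarFam u) ((1 - clamp01 u) • deriv (T.ptrack K) t + clamp01 u • deriv W.x' t) t :=
    hasDerivAt_famX hxd hxd'
  have hZf : HasDerivAt (famZ (windowBump φ κ) c hUnit (clamp01 u))
      ((c * (clamp01 u * (1 - clamp01 u)) * deriv (windowBump φ κ) t) • hUnit) t := hasDerivAt_famZ hζd
  have hZ : HasDerivAt (W.heightFam κ c u) ((c * (clamp01 u * (1 - clamp01 u)) * deriv (windowBump φ κ) t) • hUnit) t := by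
    have h := ((hzd.const_smul (1 - clamp01 u)).add (hzd'.const_smul (clamp01 u))).add hZf
    simp only [smul_zero, zero_add] at h
    exact h
  have hL : HasDerivAt (liftFam (T.ptrack K) W.x' (windowBump φ κ) c hUnit (clamp01 u))
      ((1 - clamp01 u) • deriv (T.ptrack K) t + clamp01 u • deriv W.x' t,
        (c * (clamp01 u * (1 - clamp01 u)) * deriv (windowBump φ κ) t) • hUnit) t :=
    hasDerivAt_liftFam hxd hxd' hζd
  -- the inner map and the composite
  have hmemX : W.planarFam u t ∈ range T.param := W.planarFam_mem_range_param u hts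
  have hPI : HasFDerivAt T.paramInv (fderiv ℝ T.paramInv (W.planarFam u t)) (W.planarFam u t) :=
    ((T.contDiffAt_paramInv hmemX).differentiableAt (by simp)).hasFDerivAt
  have hinner : HasDerivAt (fun s ↦ (T.paramInv (W.planarFam u s), W.heightFam κ c u s))
      (fderiv ℝ T.paramInv (W.planarFam u t) ((1 - clamp01 u) • deriv (T.ptrack K) t + clamp01 u • deriv W.x' t),
        (c * (clamp01 u * (1 - clamp01 u)) * deriv (windowBump φ κ) t) • hUnit) t :=
    (hPI.comp_hasDerivAt t hX).prodMk hZ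
  have hS : HasFDerivAt T.slabMap (fderiv ℝ T.slabMap (T.paramInv (W.planarFam u t), W.heightFam κ c u t))
      (T.paramInv (W.planarFam u t), W.heightFam κ c u t) :=
    (T.contDiff_slabMap.differentiable (by simp) _).hasFDerivAt
  have hfam : HasDerivAt (W.fam κ c u) (fderiv ℝ T.slabMap (T.paramInv (W.planarFam u t), W.heightFam κ c u t)
      (fderiv ℝ T.paramInv (W.planarFam u t) ((1 - clamp01 u) • deriv (T.ptrack K) t + clamp01 u • deriv W.x' t),
        (c * (clamp01 u * (1 - clamp01 u)) * deriv (windowBump φ κ) t) • hUnit)) t :=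
    hS.comp_hasDerivAt t hinner
  rw [hfam.deriv]
  intro h0
  have h1 := (injective_iff_map_eq_zero _).1 (T.injective_fderiv_slabMap _) _ h0
  rw [Prod.mk_eq_zero] at h1
  have h2 : (1 - clamp01 u) • deriv (T.ptrack K) t + clamp01 u • deriv W.x' t = 0 :=
    (injective_iff_map_eq_zero _).1 (T.injective_fderiv_paramInv hmemX) _ h1.1
  apply hlift
  rw [hL.deriv, h2, h1.2, Prod.mk_eq_zero]
  exact ⟨rfl, rfl⟩

/-! ### Injectivity transfer, heights on the window -/

/-- On the window the height part of the family is the lifted height `Z_u`. [folklore] -/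
theorem heightFam_eq_of_mem (κ c u : ℝ) {t : ℝ} (ht : t ∈ Icc (φ 0) (φ 1)) :
    W.heightFam κ c u t = famZ (windowBump φ κ) c hUnit (clamp01 u) t := by
  rw [heightFam, (W.x_mem ht).2.2, (W.x'_mem ht).2.2, smul_zero, smul_zero, zero_add, zero_add]

/-- **Height bound on the window**: `‖Z_u (t)‖ ≤ |c| (φ 1 - φ 0) / 8`. [folklore] -/
theorem norm_heightFam_le (κ c u : ℝ) {t : ℝ} (ht : t ∈ Icc (φ 0) (φ 1)) :
    ‖W.heightFam κ c u t‖ ≤ |c| * ((φ 1 - φ 0) / 2 / 4) := by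
  rw [W.heightFam_eq_of_mem κ c u ht]
  have h := norm_famZ_le (ζ := windowBump φ κ) (c := c) (e := hUnit) (clamp01_mem u) (abs_liftBump_le (κ₀ := κ / 2) (κ₁ := κ) ht)
  rwa [norm_hUnit, mul_one] at h

/-- The planar track of `K' ∘ σ` is injective on the window. [folklore] -/
theorem injOn_x' : InjOn W.x' (Icc (φ 0) (φ 1)) := by
  obtain ⟨T', -, -, -, hT'p, -⟩ := PatchThickening.exists_cast W.band_eq T
  have hδ₁' : b'.δ < δ₁ := W.δ_eq ▸ W.δ_lt
  have hinj' := W.lift'.injOn_planar_track T' hδ₁'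
  have hη := W.η_pos
  intro s hs t ht hst
  have hs' := W.mapsTo hs
  have ht' := W.mapsTo ht
  have h1 : W.σ s = W.σ t := by
    refine hinj' hs' ht' ?_
    simp only [hT'p]
    exact hst
  exact W.strictMonoOn.injOn ⟨by linarith [hs.1], by linarith [hs.2]⟩ ⟨by linarith [ht.1], by linarith [ht.2]⟩ h1

/-- **Injectivity transfer**: on the window, if the lifted two-arc family (at the clamped
parameter) is injective then so is the stage of `fam`. [folklore] -/
theorem injOn_fam_of {κ c u : ℝ}
    (hlift : InjOn (liftFam (T.ptrack K) W.x' (windowBump φ κ) c hUnit (clamp01 u)) (Icc (φ 0) (φ 1))) :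
    InjOn (W.fam κ c u) (Icc (φ 0) (φ 1)) := by
  have hη := W.η_pos
  intro s hs t ht hst
  rw [W.fam_eq_of_mem κ c u hs, W.fam_eq_of_mem κ c u ht] at hst
  have h := T.injective_slabMap hst
  rw [Prod.mk.injEq] at h
  have hs' : (liftFam (T.ptrack K) W.x' (windowBump φ κ) c hUnit (clamp01 u) s).1 ∈ range T.param :=
    W.planarFam_mem_range_param u ⟨by linarith [hs.1], by linarith [hs.2]⟩
  have ht' : (liftFam (T.ptrack K) W.x' (windowBump φ κ) c hUnit (clamp01 u) t).1 ∈ range T.param :=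
    W.planarFam_mem_range_param u ⟨by linarith [ht.1], by linarith [ht.2]⟩
  exact hlift hs ht (Prod.ext (T.injOn_paramInv hs' ht' h.1) h.2)

/-! ### Avoiding the rest of `K` -/

/-- A point of `K` in the band surface, off the closed lower arc, lies on the open upper arc: its
planar coordinate has `x₁ > 1/2`. [folklore] -/
theorem half_lt_planar_of_mem_support {t : ℝ} (ht : K (circlePt t) ∉ b.lowerCurve '' Icc 0 1)
    (hsupp : K (circlePt t) ∈ b.support) : 2⁻¹ < T.planar (K (circlePt t)) 1 := by
  obtain ⟨q, hq, hqe⟩ := hsupp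
  have hmem : q ∈ b.band ⁻¹' range K ∩ squareNhd b.δ := ⟨⟨_, hqe.symm⟩, hq⟩
  rw [b.preimage_range] at hmem
  rcases hmem with ⟨s, hs, rfl⟩ | ⟨s, hs, rfl⟩
  · exact absurd ⟨s, Ioo_subset_Icc_self hs, hqe⟩ ht
  · rw [← hqe, T.planar_apply_patch (b.closedSquare_subset_range_param T W.δ_lt
      (b.upperArc_mem_closedSquare (Ioo_subset_Icc_self hs)))]
    exact (b.upperArc_mem s hs).2

/-- **The stages avoid the rest of `K`.** With corner controls `rA`, `rB` at the two attaching
points (`exists_radius_planar_one_lt`, `…_right`), proximity radii `ρA`, `ρB` (`exists_emb_near`),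
corner zones of width `κc` (`exists_near_A/B`), the height bound `h₀` of the rest of `K` over the
compact planar set `Q` containing the middle of the family (`exists_height_bound`), and a height
scale with `‖Z‖ ≤ hmax` below all of these: no stage meets a point of `K` off the closed lower arc.
[folklore] -/
theorem fam_ne_curve {κ c : ℝ} (hκ : 0 < κ) {κc rA rB ρA ρB h₀ hmax : ℝ} {Q : Set (𝔼 2)}
    (hCA : ∀ c' ∈ range K, dist c' (b.band (pt2 0 (-b.δ))) < rA → c' ∉ b.support → c' ≠ b.band (pt2 0 (-b.δ)) →
      c' ∈ range T.emb ∧ T.planar c' 1 < -b.δ)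
    (hCB : ∀ c' ∈ range K, dist c' (b.band (pt2 1 (-b.δ))) < rB → c' ∉ b.support → c' ≠ b.band (pt2 1 (-b.δ)) →
      c' ∈ range T.emb ∧ T.planar c' 1 < -b.δ)
    (hnearA : ∀ (X : 𝔼 2) (Z : 𝔼 1), X ∈ range T.param → dist X (pt2 0 (-b.δ)) < ρA → ‖Z‖ < ρA →
      dist (T.emb (slabEquiv.symm (T.paramInv X, Z))) (b.band (pt2 0 (-b.δ))) < rA)
    (hnearB : ∀ (X : 𝔼 2) (Z : 𝔼 1), X ∈ range T.param → dist X (pt2 1 (-b.δ)) < ρB → ‖Z‖ < ρB →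
      dist (T.emb (slabEquiv.symm (T.paramInv X, Z))) (b.band (pt2 1 (-b.δ))) < rB)
    (hzoneA : ∀ u, ∀ s ∈ Icc (φ 0) (φ 0 + κc), dist (W.planarFam u s) (pt2 0 (-b.δ)) < ρA)
    (hzoneB : ∀ u, ∀ s ∈ Icc (φ 1 - κc) (φ 1), dist (W.planarFam u s) (pt2 1 (-b.δ)) < ρB)
    (hQ : ∀ u, ∀ s ∈ Icc (φ 0 + κc) (φ 1 - κc), W.planarFam u s ∈ Q)
    (hh₀ : ∀ t : ℝ, K (circlePt t) ∉ b.lowerCurve '' Ioo 0 1 → K (circlePt t) ∈ range T.emb →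
      T.planar (K (circlePt t)) ∈ Q → ‖T.height (K (circlePt t))‖ ≤ 1 → h₀ ≤ ‖T.height (K (circlePt t))‖)
    (hbound : ∀ u, ∀ s ∈ Icc (φ 0) (φ 1), ‖W.heightFam κ c u s‖ ≤ hmax)
    (hmaxA : hmax < ρA) (hmaxB : hmax < ρB) (hmax0 : hmax < h₀) (hmax1 : hmax ≤ 1)
    {u s t : ℝ} (hs : s ∈ Icc (φ 0) (φ 1)) (ht : K (circlePt t) ∉ b.lowerCurve '' Icc 0 1) :
    W.fam κ c u s ≠ Knot.curve K t := by
  have hη := W.η_pos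
  have hsI : s ∈ Ioo (φ 0 - W.η) (φ 1 + W.η) := ⟨by linarith [hs.1], by linarith [hs.2]⟩
  intro heq
  by_cases hin : s ∈ Ioo (φ 0) (φ 1)
  swap
  · -- at an end of the window the stage is an attaching point
    rw [W.fam_eq_curve_of_not_mem hκ c u hsI hin, Knot.curve_eq_curve_iff] at heq
    obtain ⟨m, hm⟩ := heq
    apply ht
    have hKt : K (circlePt t) = K (circlePt s) := by
      rw [hm, show t + (m : ℝ) = t + ((m : ℤ) : ℝ) from rfl, circlePt_add_int]
    rw [mem_Ioo, not_and_or, not_lt, not_lt] at hin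
    rcases hin with h | h
    · have hs0 : s = φ 0 := le_antisymm h hs.1
      rw [hKt, hs0, W.lift.apply_zero, ← lowerCurve_zero]
      exact ⟨0, left_mem_Icc.2 zero_le_one, rfl⟩
    · have hs1 : s = φ 1 := le_antisymm hs.2 h
      rw [hKt, hs1, W.lift.apply_one, ← lowerCurve_one]
      exact ⟨1, right_mem_Icc.2 zero_le_one, rfl⟩
  -- inside the window: coordinates of the point of `K`
  set X : 𝔼 2 := W.planarFam u s with hX
  set Z : 𝔼 1 := W.heightFam κ c u s with hZ
  have hXσ : X ∈ range T.param := W.planarFam_mem_range_param u hsI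
  have hpt : K (circlePt t) = T.emb (slabEquiv.symm (T.paramInv X, Z)) := Subtype.ext heq.symm
  have hmem : K (circlePt t) ∈ range T.emb := hpt ▸ mem_range_self _
  have hpl : T.planar (K (circlePt t)) = X := by rw [hpt, T.planar_emb, T.param_paramInv hXσ]
  have hhg : T.height (K (circlePt t)) = Z := by rw [hpt, T.height_emb]
  obtain ⟨hXsq, hX1⟩ := W.planarFam_mem_of_mem_Ioo u hin
  have hXbot : -b.δ < X 1 := (hXsq 1).1
  have ht' : K (circlePt t) ∉ b.lowerCurve '' Ioo 0 1 := fun h ↦ ht (image_mono Ioo_subset_Icc_self h)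
  by_cases hsupp : K (circlePt t) ∈ b.support
  · have := W.half_lt_planar_of_mem_support ht hsupp
    rw [hpl] at this
    linarith
  -- off the band surface
  have hZle : ‖Z‖ ≤ hmax := hbound u s hs
  by_cases hsA : s ≤ φ 0 + κc
  · -- in the corner zone at `A`
    have hd : dist (K (circlePt t)) (b.band (pt2 0 (-b.δ))) < rA := by
      rw [hpt]; exact hnearA X Z hXσ (hzoneA u s ⟨hs.1, hsA⟩) (lt_of_le_of_lt hZle hmaxA)
    have hne : K (circlePt t) ≠ b.band (pt2 0 (-b.δ)) := by
      intro h; apply ht; rw [h, ← lowerCurve_zero]; exact ⟨0, left_mem_Icc.2 zero_le_one, rfl⟩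
    have := (hCA _ (mem_range_self _) hd hsupp hne).2
    rw [hpl] at this
    linarith
  by_cases hsB : φ 1 - κc ≤ s
  · -- in the corner zone at `B`
    have hd : dist (K (circlePt t)) (b.band (pt2 1 (-b.δ))) < rB := by
      rw [hpt]; exact hnearB X Z hXσ (hzoneB u s ⟨hsB, hs.2⟩) (lt_of_le_of_lt hZle hmaxB)
    have hne : K (circlePt t) ≠ b.band (pt2 1 (-b.δ)) := by
      intro h; apply ht; rw [h, ← lowerCurve_one]; exact ⟨1, right_mem_Icc.2 zero_le_one, rfl⟩
    have := (hCB _ (mem_range_self _) hd hsupp hne).2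
    rw [hpl] at this
    linarith
  · -- in the middle: the rest of `K` is higher than the family
    push Not at hsA hsB
    have hXQ : T.planar (K (circlePt t)) ∈ Q := by rw [hpl]; exact hQ u s ⟨hsA.le, hsB.le⟩
    have h1 := hh₀ t ht' hmem hXQ (by rw [hhg]; exact hZle.trans hmax1)
    rw [hhg] at h1
    linarith

/-! ### Good parameters -/

/-- The compact planar set swept by the middle of the family. [folklore] -/
theorem isCompact_middle {κc : ℝ} (hκc : 0 ≤ κc) :
    IsCompact ((fun q : ℝ × ℝ ↦ famX (T.ptrack K) W.x' q.1 q.2) '' (Icc (0 : ℝ) 1 ×ˢ Icc (φ 0 + κc) (φ 1 - κc))) :=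
  (isCompact_Icc.prod isCompact_Icc).image_of_continuousOn (W.continuousOn_famX.mono
    (prod_mono (subset_univ _) (Icc_subset_Icc (by linarith) (by linarith))))

/-- The middle set lies in the open lower half (for a positive corner width). [folklore] -/
theorem middle_subset {κc : ℝ} (hκc : 0 < κc) :
    (fun q : ℝ × ℝ ↦ famX (T.ptrack K) W.x' q.1 q.2) '' (Icc (0 : ℝ) 1 ×ˢ Icc (φ 0 + κc) (φ 1 - κc)) ⊆
      {x | x ∈ squareNhd b.δ ∧ x 1 < 2⁻¹} := by
  rintro _ ⟨q, hq, rfl⟩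
  have hq2 : q.2 ∈ Ioo (φ 0) (φ 1) := ⟨by linarith [hq.2.1], by linarith [hq.2.2]⟩
  exact (convex_squareNhd_inter_lt b.δ).segment_subset (W.x_mem_of_mem_Ioo hq2) (W.x'_mem_of_mem_Ioo hq2)
    (famX_mem_segment hq.1 q.2)

omit W in
/-- The coordinate of the derivative is the derivative of the coordinate. [folklore] -/
theorem _root_.Literature.Topology.FourManifolds.deriv_apply_eq_deriv_coord {f : ℝ → 𝔼 2} {t : ℝ}
    (hf : DifferentiableAt ℝ f t) (i : Fin 2) : deriv f t i = deriv (fun s ↦ f s i) t := by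
  symm
  exact ((EuclideanSpace.proj i : 𝔼 2 →L[ℝ] ℝ).hasFDerivAt.comp_hasDerivAt t hf.hasDerivAt).deriv

/-- **Good parameters.** For a margin `κ` and a height scale `c` suitably small, every stage of the
family is injective and regular on the window, avoids the rest of `K` (points of `K` off the closed
lower arc), and stays in the lower half of the thickened band inside the neighbourhood `V`
(a tube `‖h‖ ≤ z₁` over the closed collar square being given inside `V`). [folklore] -/
theorem exists_good {V : Set (𝕊 3)} {z₁ : ℝ} (hz₁ : 0 < z₁)
    (hVtube : ∀ (y : 𝔼 2) (h : 𝔼 1), T.param y ∈ closedSquare b.δ → ‖h‖ ≤ z₁ → T.emb (slabEquiv.symm (y, h)) ∈ V) :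
    ∃ κ c : ℝ, 0 < κ ∧ 0 < c ∧
      (∀ u, InjOn (W.fam κ c u) (Icc (φ 0) (φ 1))) ∧
      (∀ u, ∀ t ∈ Icc (φ 0) (φ 1), deriv (W.fam κ c u) t ≠ 0) ∧
      (∀ u, ∀ s ∈ Icc (φ 0) (φ 1), ∀ t, K (circlePt t) ∉ b.lowerCurve '' Icc 0 1 → W.fam κ c u s ≠ Knot.curve K t) ∧
      (∀ u, ∀ s ∈ Icc (φ 0) (φ 1), ∃ (y : 𝔼 2) (h : 𝔼 1), W.fam κ c u s = T.slabMap (y, h) ∧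
        T.param y 1 < 2⁻¹ ∧ T.emb (slabEquiv.symm (y, h)) ∈ V) := by
  have hη := W.η_pos
  have h01 := W.lift.zero_lt_one
  -- zones at the ends
  obtain ⟨κA, hκA, -, hκA2, hAeq, hAmono, hAder⟩ := W.exists_zoneA
  obtain ⟨κB, hκB, -, hκB2, hBeq, hBmono, hBder⟩ := W.exists_zoneB
  set κ₃ : ℝ := min κA κB with hκ₃
  have hκ₃0 : 0 < κ₃ := lt_min hκA hκB
  have hκ₃A : κ₃ ≤ κA := min_le_left _ _
  have hκ₃B : κ₃ ≤ κB := min_le_right _ _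
  have hκ₃2 : 2 * κ₃ < φ 1 - φ 0 := by linarith
  -- separation radii and near zones
  obtain ⟨ρA, hρA, hfarA⟩ := W.exists_far_A hκ₃0 hκ₃2
  obtain ⟨ρB, hρB, hfarB⟩ := W.exists_far_B hκ₃0 hκ₃2
  obtain ⟨κ₁A, hκ₁A, hnearA⟩ := W.exists_near_A hρA
  obtain ⟨κ₁B, hκ₁B, hnearB⟩ := W.exists_near_B hρB
  set κ₁ : ℝ := min (min κ₁A κ₁B) (κ₃ / 2) with hκ₁
  have hκ₁0 : 0 < κ₁ := lt_min (lt_min hκ₁A hκ₁B) (by positivity)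
  have hκ₁a : κ₁ ≤ κ₁A := (min_le_left _ _).trans (min_le_left _ _)
  have hκ₁b : κ₁ ≤ κ₁B := (min_le_left _ _).trans (min_le_right _ _)
  have hκ₁3 : κ₁ < κ₃ := by linarith [min_le_right (min κ₁A κ₁B) (κ₃ / 2)]
  -- corner controls, proximity radii, corner zones
  obtain ⟨rA, hrA, hCA⟩ := b.exists_radius_planar_one_lt T W.δ_lt W.disjoint
  obtain ⟨rB, hrB, hCB⟩ := b.exists_radius_planar_one_lt_right T W.δ_lt W.disjoint
  have hAσ : (pt2 0 (-b.δ) : 𝔼 2) ∈ range T.param :=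
    b.closedSquare_subset_range_param T W.δ_lt (b.corner_mem_closedSquare (Or.inl rfl) (Or.inl rfl))
  have hBσ : (pt2 1 (-b.δ) : 𝔼 2) ∈ range T.param :=
    b.closedSquare_subset_range_param T W.δ_lt (b.corner_mem_closedSquare (Or.inr rfl) (Or.inl rfl))
  obtain ⟨ρcA, hρcA, hembA⟩ := WindowMatching.exists_emb_near (b := b) (T := T) hAσ hrA
  obtain ⟨ρcB, hρcB, hembB⟩ := WindowMatching.exists_emb_near (b := b) (T := T) hBσ hrB
  obtain ⟨κcA, hκcA, hzoneA⟩ := W.exists_near_A hρcA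
  obtain ⟨κcB, hκcB, hzoneB⟩ := W.exists_near_B hρcB
  set κc : ℝ := min (min κcA κcB) ((φ 1 - φ 0) / 4) with hκc
  have hκc0 : 0 < κc := lt_min (lt_min hκcA hκcB) (by linarith)
  have hκca : κc ≤ κcA := (min_le_left _ _).trans (min_le_left _ _)
  have hκcb : κc ≤ κcB := (min_le_left _ _).trans (min_le_right _ _)
  have hκc2 : 2 * κc < φ 1 - φ 0 := by linarith [min_le_right (min κcA κcB) ((φ 1 - φ 0) / 4)]
  -- the middle set and the height bound of the rest of `K`
  set Q : Set (𝔼 2) := (fun q : ℝ × ℝ ↦ famX (T.ptrack K) W.x' q.1 q.2) '' (Icc (0 : ℝ) 1 ×ˢ Icc (φ 0 + κc) (φ 1 - κc))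
    with hQdef
  obtain ⟨h₀, hh₀, hheight⟩ := W.exists_height_bound (W.isCompact_middle hκc0.le) (W.middle_subset hκc0)
  -- the height scale
  set m : ℝ := min (min (min ρcA ρcB) (min h₀ z₁)) 1 with hm
  have hm0 : 0 < m := lt_min (lt_min (lt_min hρcA hρcB) (lt_min hh₀ hz₁)) one_pos
  have hmA : m ≤ ρcA := ((min_le_left _ _).trans (min_le_left _ _)).trans (min_le_left _ _)
  have hmB : m ≤ ρcB := ((min_le_left _ _).trans (min_le_left _ _)).trans (min_le_right _ _)
  have hmh : m ≤ h₀ := ((min_le_left _ _).trans (min_le_right _ _)).trans (min_le_left _ _)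
  have hmz : m ≤ z₁ := ((min_le_left _ _).trans (min_le_right _ _)).trans (min_le_right _ _)
  have hm1 : m ≤ 1 := min_le_right _ _
  set c : ℝ := 4 * m / (φ 1 - φ 0) with hcdef
  have hc0 : 0 < c := by rw [hcdef]; exact div_pos (by linarith) (by linarith)
  have hne : φ 1 - φ 0 ≠ 0 := by linarith
  have hbound : ∀ u, ∀ s ∈ Icc (φ 0) (φ 1), ‖W.heightFam κ₁ c u s‖ ≤ m / 2 := by
    intro u s hs
    refine (W.norm_heightFam_le κ₁ c u hs).trans (le_of_eq ?_)
    rw [abs_of_pos hc0, hcdef]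
    field_simp
  refine ⟨κ₁, c, hκ₁0, hc0, ?_, ?_, ?_, ?_⟩
  · -- injectivity
    intro u
    refine W.injOn_fam_of (injOn_liftFam (t₀ := φ 0) (t₁ := φ 1) (α₁ := φ 0 + κ₁) (α₃ := φ 0 + κ₃)
      (β₃ := φ 1 - κ₃) (β₁ := φ 1 - κ₁) (A := pt2 0 (-b.δ)) (B := pt2 1 (-b.δ)) (ρ := ρA) (ρ' := ρB)
      hc0.ne' hUnit_ne_zero ?_ ?_ ?_ ?_ ?_ ?_ ?_ ?_ ?_ ?_ ?_ (clamp01_mem u))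
    · exact fun t ht ↦ hAeq t ⟨ht.1, ht.2.trans (by linarith)⟩
    · exact hAmono.mono (Icc_subset_Icc le_rfl (by linarith))
    · exact fun t ht ↦ hBeq t ⟨le_trans (by linarith) ht.1, ht.2⟩
    · exact hBmono.mono (Icc_subset_Icc (by linarith) le_rfl)
    · exact strictMonoOn_liftBump (by linarith)
    · exact W.lift.injOn_planar_track T W.δ_lt
    · exact W.injOn_x'
    · exact fun v hv t ht ↦ hnearA v hv t ⟨ht.1, ht.2.trans (by linarith)⟩
    · exact hfarA
    · exact fun v hv t ht ↦ hnearB v hv t ⟨le_trans (by linarith) ht.1, ht.2⟩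
    · exact hfarB
  · -- regularity
    intro u t ht
    have hts : t ∈ Ioo (φ 0 - W.η) (φ 1 + W.η) := ⟨by linarith [ht.1], by linarith [ht.2]⟩
    refine W.deriv_fam_ne_zero_of ht (deriv_liftFam_ne_zero (t₀ := φ 0) (t₁ := φ 1) (α₃ := φ 0 + κ₃)
      (α₃' := φ 0 + κ₁) (β₃' := φ 1 - κ₁) (β₃ := φ 1 - κ₃) hc0.ne' hUnit_ne_zero (by linarith) (by linarith)
      ?_ ?_ ?_ ?_ ?_ ?_ ?_ ?_ (clamp01_mem u) ht)
    · exact fun s hs ↦ (W.contDiffAt_x ⟨by linarith [hs.1], by linarith [hs.2]⟩).differentiableAt (by simp)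
    · exact fun s hs ↦ (W.contDiffAt_x' ⟨by linarith [hs.1], by linarith [hs.2]⟩).differentiableAt (by simp)
    · exact fun s _ ↦ (contDiff_windowBump φ κ₁).differentiable (by simp) s
    · exact fun s hs ↦ W.deriv_x_ne_zero hs
    · exact fun s hs ↦ W.deriv_x'_ne_zero hs
    · intro s hs
      have hs' : s ∈ Icc (φ 0) (φ 0 + κA) := ⟨hs.1, hs.2.trans (by linarith)⟩
      have hsI : s ∈ Ioo (φ 0 - W.η) (φ 1 + W.η) := ⟨by linarith [hs.1], by linarith [hs.2]⟩
      obtain ⟨h1, h2⟩ := hAder s hs'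
      rw [deriv_apply_eq_deriv_coord ((W.contDiffAt_x hsI).differentiableAt (by simp)),
        deriv_apply_eq_deriv_coord ((W.contDiffAt_x' hsI).differentiableAt (by simp))]
      exact ⟨h1, h2⟩
    · intro s hs
      have hs' : s ∈ Icc (φ 1 - κB) (φ 1) := ⟨le_trans (by linarith) hs.1, hs.2⟩
      have hsI : s ∈ Ioo (φ 0 - W.η) (φ 1 + W.η) := ⟨by linarith [hs.1], by linarith [hs.2]⟩
      obtain ⟨h1, h2⟩ := hBder s hs'
      rw [deriv_apply_eq_deriv_coord ((W.contDiffAt_x hsI).differentiableAt (by simp)),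
        deriv_apply_eq_deriv_coord ((W.contDiffAt_x' hsI).differentiableAt (by simp))]
      exact ⟨h1, h2⟩
    · intro s hs
      rw [show windowBump φ κ₁ = liftBump (φ 0) (φ 1) (κ₁ / 2) κ₁ from rfl,
        (hasDerivAt_liftBump (t₀ := φ 0) (t₁ := φ 1) (κ₀ := κ₁ / 2) (κ₁ := κ₁) (by linarith) hs).deriv]
      exact one_ne_zero
  · -- avoiding the rest of `K`
    intro u s hs t ht
    refine W.fam_ne_curve hκ₁0 (κc := κc) (rA := rA) (rB := rB) (ρA := ρcA) (ρB := ρcB) (h₀ := h₀) (hmax := m / 2)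
      (Q := Q) hCA hCB hembA hembB ?_ ?_ ?_ hheight hbound (by linarith) (by linarith) (by linarith)
      (by linarith) hs ht
    · intro v s' hs'
      exact hzoneA (clamp01 v) (clamp01_mem v) s' ⟨hs'.1, hs'.2.trans (by linarith)⟩
    · intro v s' hs'
      exact hzoneB (clamp01 v) (clamp01_mem v) s' ⟨le_trans (by linarith) hs'.1, hs'.2⟩
    · intro v s' hs'
      exact ⟨(clamp01 v, s'), ⟨clamp01_mem v, hs'⟩, rfl⟩
  · -- location
    intro u s hs
    have hsI : s ∈ Ioo (φ 0 - W.η) (φ 1 + W.η) := ⟨by linarith [hs.1], by linarith [hs.2]⟩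
    refine ⟨T.paramInv (W.planarFam u s), W.heightFam κ₁ c u s, rfl, ?_, ?_⟩
    · rw [T.param_paramInv (W.planarFam_mem_range_param u hsI)]
      exact (W.planarFam_mem u hs).2
    · refine hVtube _ _ ?_ ((hbound u s hs).trans (by linarith))
      rw [T.param_paramInv (W.planarFam_mem_range_param u hsI)]
      exact (W.planarFam_mem u hs).1

end WindowMatching

end BandData

end Literature.Topology.FourManifolds
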